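import Literature.NumberTheory.LFunctions.CriticalLineTwoThirdsReduction
import Literature.Analysis.SpecialFunctions.DigammaGauss
import HarnessLib

/-!
# RH-FREE — «nothing here bears on the truth of RH»: Alpöge–Furman 2026 (arXiv:2608.13637) §5.3 for the typed model of Theorem 5.7 — the bilinear form `𝓜[u₁,u₂]`, the split (5.11) of `𝓜`, the Plancherel/inversion identities `∫Φ² = 2π∫φ⁴`, (5.12), the archimedean term (Proposition 5.3) and the cross terms (Proposition 5.5) to the precision `O(T L²)` — PROVED

Topic `Literature/NumberTheory/LFunctions` (namespace `Literature.NumberTheory.LFunctions.AlpogeFurman2026`).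
Cell `rh-columns/lit`, unit `rh-lit-frontier-1` (gen 8). Source: **[AF26]** L. Alpöge, R. Furman,
*More than two thirds of the zeros of the Riemann zeta function are simple and on the critical
line*, arXiv:2608.13637v2 (19 Aug 2026), UNREFEREED preprint (D-0012); locators = printed
equation / proposition numbers and pages of v2. NO claim, NO `sorry`, no new named fact: every
statement below is a `theorem` (or a `def` with a body: the source's own auxiliary objects
`𝓜[u₁,u₂]` and `g = φ² ⋆ φ²`), proved from Mathlib and the companion files
`CriticalLineTwoThirdsReduction` (`formM = 𝓜`, `exists_abs_weilDensity_le`),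
`CriticalLineTwoThirdsPrimeSideSetup` (`PhiR = Φ`, `hatR = φ̂ʳ`, the Lorentzian majorant
`lorentz M A` with `exists_majorant`, `integral_lorentz`, `setIntegral_lorentz_sq_le`),
`CriticalLineTwoThirdsExplicitFormula` (`archDensity = μ`, `polarDensity = Π_X`,
`primeDensity = P_X`, `weilDensity = ν_X`, Mellin inversion on the critical line
`integral_weilMellin_half`, `integral_weilMellin_half_mul_cos`) and `CriticalLineTwoThirdsMatrix`
(`phi = φ_T`, `logHeight = L`, `IsWindow`).

## What the source prints (§5.1, §5.3; pp. 7, 9–10)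

* (5.1): "`Φ := (φ²)^`, `g := φ² ⋆ φ²`, …, `(v ⋆ v)(y) := ∫ v(u)v(u+y)du`"; "`∫_ℝ Φ² = 2π g(0) = 2πbL`"
  (`b := L⁻¹∫φ⁴`); (5.12): "`∫_ℝ Φ(x)² e^{ixy} dx = 2π g(y)` (`y ∈ ℝ`)" (Fourier inversion of
  `Φ² = ĝ`, `g` even, continuous, compactly supported).
* §5.3: "For functions `u₁, u₂` on `I` write `𝓜[u₁,u₂] := ∬_{I×I} Φ(τ−τ′)² u₁(τ)u₂(τ′) dτ dτ′`, a
  symmetric bilinear form (`Φ²` is even), so that (5.11)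
  `𝓜 = 𝓜[μ,μ] + 𝓜[P_X,P_X] + 2𝓜[μ,P_X] + 2𝓜[μ,Π_X] + 2𝓜[P_X,Π_X] + 𝓜[Π_X,Π_X]`."
* **Proposition 5.3** (Archimedean term): "`𝓜[μ,μ] = 2πbL∫_T^{2T}μ² + O(l² log L)
  = (bLTℓ₁²/2π)(1 + O(l⁻²)) + O(l² log L)`."
* **Proposition 5.5** (Cross terms): "`𝓜[μ,P_X], 𝓜[μ,Π_X], 𝓜[P_X,Π_X], 𝓜[Π_X,Π_X] ≪_χ L²√X`";
  proof: "on `I` we have `|Π_X| ≤ 3√X/T`, `0 < μ ≤ l`, `|P_X| ≤ √X` …, and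
  `sup_τ ∫_I Φ(τ−τ′)² dτ′ ≤ 2πbL`; the remaining three bounds follow by inserting these sup bounds
  into the definition of `𝓜[·,·]`"; for `𝓜[μ,P_X]` an integration by parts in `τ′` against
  `cos(τ′ log n)`.
* Theorem 5.7 (proof, p. 11): "`‖φ‖₂² = L∫ψ + O_χ(1)`, `‖φ‖₄⁴ = L∫ψ² + O_χ(1)`".

## What is here (for the typed model: `φ_T = χχ·√ψ(·/L)`, `X = T/2π`, `I = [T,2T]`)

The typed Theorem 5.7 (`AlpogeFurman2026_hilbertSchmidt`, error `C·N/L`) only needs every piece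
of `𝓜` to precision `O(T·L²)` (`(L∫φ²)⁻²·L²·O(TL²) = O(T) = O(N/L)`); to that precision the
archimedean and cross terms are elementary, and this file proves them in that form:
* §A1 `|∫φ_T² − L∫_{−½}^{½}ψ| ≤ 2 sup ψ`, `|∫φ_T⁴ − L∫_{−½}^{½}ψ²| ≤ 2 (sup ψ)²`
  (`abs_integral_phi_sq_sub_le`, `abs_integral_phi_pow_four_sub_le`).
* §A2 `Φ²` is integrable; `g = gConv` (real, even, `g(0) = ∫φ⁴`); **`∫_ℝ Φ² = 2π∫φ⁴`**
  (`integral_PhiR_sq`) and **(5.12)** `∫_ℝ Φ(x)² cos(xy) dx = 2π g(y)` (`integral_PhiR_sq_mul_cos`),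
  both by the tree's Mellin inversion on the critical line applied to `g = φ² ⋆ φ²`
  (`(φ² ⋆ φ²)^(½+iy) = Φ(y)²`).
* §A3 the bilinear form `formB ψ T u₁ u₂ = 𝓜[u₁,u₂]` (same iterated-integral shape as `formM`, so
  `formM = formB ν_X ν_X` by `rfl`), bilinearity, symmetry (Fubini), and the sup bound
  `|𝓜[u₁,u₂]| ≤ sup_I|u₁|·sup_I|u₂|·T·∫_ℝΦ²` (`abs_formB_le`).
* §A4 pointwise bounds on `I`: `|Π_X| ≤ 1/√T`, `|P_X| ≤ c√T`, `|μ − L/2π| ≤ 1`, `|μ| ≤ L`.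
* §A5 **Proposition 5.3 to precision `O(TL²)`**: `|𝓜[μ,μ] − (TL²/2π)∫φ_T⁴| ≤ C·T·L²`
  (`AlpogeFurman2026_arch_term`) — from `μ = L/2π + O(1)` on `I`, `𝓜[1,1] = T∫Φ² + O(T)`
  (tails of `Φ² ≤ ϑ²` beyond distance `1`) and `∫Φ² = 2π∫φ⁴`; the source's sharper form (with
  `∫_T^{2T}μ²` and error `O(l² log L)`) is not needed by the typed statement and is not proved.
* §A6 **Proposition 5.5 for the three `Π_X` terms and (by the sup bound) the split (5.11)**:
  `|𝓜 − (𝓜[μ,μ] + 𝓜[P_X,P_X] + 2𝓜[P_X,μ])| ≤ C·T·L²` (`AlpogeFurman2026_formM_split`).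
* §A7 **Proposition 5.5 for `𝓜[μ,P_X]` to precision `O(TL²)`**: `|𝓜[P_X,μ]| ≤ C·T·L²`
  (`AlpogeFurman2026_cross_arch_prime`) — `μ` replaced by `(1/2π)log(τ′/2π)` (error `≤ 1/T` on
  `I`), then for each `n ≤ X` one integration by parts in `τ′` of
  `u(τ′)·[cos(τ′y)C(τ′) − sin(τ′y)S(τ′)]` (`y = log n ≥ log 2`, `C, S` the `x`-integrals of
  `Φ(x)²cos(xy)`, `Φ(x)²sin(xy)` over `I − τ′`, differentiated by the fundamental theorem of
  calculus), giving `≪ L·∫Φ²` per `n` and `≪ L²·Σ_{n≤X}Λ(n)/√n ≪ L²√T` in all.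

DEVIATIONS (recorded, no endorsement either way): constants are cruder than printed (`Θ₀ ≍ √L`);
the error terms are stated as `C·T·L²`, which is what the typed Theorem 5.7 consumes; the bound
`|μ(τ) − (1/2π)log(τ/2π)| ≤ 1/τ` comes from the tree's `abs_re_digamma_sub_log_norm_le`
(Gauss's formula), in place of the source's appeal to (2.3).

STATUS NOTE (no endorsement). Elementary real analysis on the source's auxiliary objects; nothing
here evaluates the prime term `𝓜[P_X,P_X]` (Proposition 5.4) and nothing asserts Theorem 5.7,
Theorem A, or RH. [AF26] is an unrefereed preprint.

## References
* [AlpogeFurman2026] as above: §5.1 eqs. (5.1), (5.2) (p. 7); §5.3 eq. (5.11), (5.12),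
  Propositions 5.3, 5.5 (pp. 9–10); Theorem 5.7 (proof, p. 11).
* [Bombieri2000Weil] E. Bombieri, Rend. Mat. Acc. Lincei (9) 11 (2000), §2 — Mellin inversion on
  the critical line, via the tree's `CriticalLineTwoThirdsExplicitFormula`.
-/

noncomputable section

open Complex Filter Set MeasureTheory
open scoped Real Topology ComplexConjugate ArithmeticFunction.vonMangoldt

namespace Literature.NumberTheory.LFunctions

namespace AlpogeFurman2026

variable {ψ : ℝ → ℝ}

/-! ## §A1. The window integrals `∫φ_T²`, `∫φ_T⁴` against `L∫ψ`, `L∫ψ²` -/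

/-- On the bulk `|u| ≤ L/2 − 1` both ramps equal `1` and the clamp is inactive:
`φ_T(u)² = ψ(u/L)`. [cite: AlpogeFurman2026, §2.2 (p. 4: "`φ²(u) = ψ(u/L)` off two transition intervals of length `O_χ(1)`")] -/
theorem phi_sq_eq_of_abs_le (hψ : IsWindow ψ) {T u : ℝ} (hL : 0 < logHeight T)
    (hu : |u| ≤ logHeight T / 2 - 1) : phi ψ T u ^ 2 = ψ (u / logHeight T) := by
  have hu' := abs_le.1 hu
  have hmem : u / logHeight T ∈ Icc (-(1 / 2 : ℝ)) (1 / 2) := by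
    constructor
    · rw [le_div_iff₀ hL]; linarith
    · rw [div_le_iff₀ hL]; linarith
  rw [phi, smoothRamp_of_one_le (by linarith), smoothRamp_of_one_le (by linarith), one_mul, one_mul,
    clampHalf_of_mem hmem, Real.sq_sqrt (hψ.pos _ hmem).le]

/-- Everywhere `φ_T(u)² ≤ ψ(clamp(u/L))` (the ramps are `≤ 1`). [cite: AlpogeFurman2026, §2.2 (p. 4)] -/
theorem phi_sq_le_clamp (hψ : IsWindow ψ) (T u : ℝ) :
    phi ψ T u ^ 2 ≤ ψ (clampHalf (u / logHeight T)) := by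
  have hψ0 : 0 ≤ ψ (clampHalf (u / logHeight T)) := (hψ.pos _ (clampHalf_mem _)).le
  have ha := smoothRamp_nonneg (logHeight T / 2 + u)
  have hb := smoothRamp_nonneg (logHeight T / 2 - u)
  have ha1 := smoothRamp_le_one (logHeight T / 2 + u)
  have hb1 := smoothRamp_le_one (logHeight T / 2 - u)
  have hab : smoothRamp (logHeight T / 2 + u) * smoothRamp (logHeight T / 2 - u) ≤ 1 := by nlinarith
  have hab0 : 0 ≤ smoothRamp (logHeight T / 2 + u) * smoothRamp (logHeight T / 2 - u) := by positivity
  rw [phi, mul_pow, Real.sq_sqrt hψ0]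
  have h1 : (smoothRamp (logHeight T / 2 + u) * smoothRamp (logHeight T / 2 - u)) ^ 2 ≤ 1 := by nlinarith
  nlinarith

/-- `u ↦ ψ(clamp(u/L))` is continuous for a window. [cite: AlpogeFurman2026, §2.2 (p. 4)] -/
theorem IsWindow.continuous_clamp (hψ : IsWindow ψ) (L : ℝ) :
    Continuous fun u : ℝ ↦ ψ (clampHalf (u / L)) :=
  hψ.continuousOn.comp_continuous (continuous_clampHalf.comp (continuous_id.div_const _))
    fun _ ↦ clampHalf_mem _

/-- `∫_{−L/2}^{L/2} F(ψ(clamp(u/L))) du = L ∫_{−½}^{½} F(ψ(v)) dv` (`L > 0`; substitution `u = Lv`).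
[cite: AlpogeFurman2026, Theorem 5.7 (proof: "Rescaling `φ²(u) = ψ(u/L) + O(…)`"), p. 11] -/
theorem integral_clamp_comp (F : ℝ → ℝ) {L : ℝ} (hL : 0 < L) :
    ∫ u in (-(L / 2))..(L / 2), F (ψ (clampHalf (u / L))) =
      L * ∫ v in (-(1 / 2 : ℝ))..(1 / 2), F (ψ v) := by
  have h := intervalIntegral.integral_comp_div (fun x ↦ F (ψ (clampHalf x))) (a := -(L / 2))
    (b := L / 2) hL.ne'
  rw [h, smul_eq_mul]
  have e1 : -(L / 2) / L = -(1 / 2 : ℝ) := by field_simp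
  have e2 : L / 2 / L = (1 / 2 : ℝ) := by field_simp
  rw [e1, e2]
  congr 1
  refine intervalIntegral.integral_congr fun v hv ↦ ?_
  rw [uIcc_of_le (by norm_num)] at hv
  simp only [clampHalf_of_mem hv]

/-- The comparison behind "`‖φ‖₂² = L∫ψ + O_χ(1)`, `‖φ‖₄⁴ = L∫ψ² + O_χ(1)`": if `0 ≤ G ≤ H ≤ M`
pointwise, `G = H` on the bulk `|u| ≤ L/2 − 1`, and `G = 0` off `[−L/2, L/2]`, then
`|∫_ℝ G − ∫_{−L/2}^{L/2} H| ≤ 2M` (`L ≥ 2`). [cite: AlpogeFurman2026, Theorem 5.7 (proof), p. 11] -/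
theorem abs_integral_sub_bulk_le {G H : ℝ → ℝ} (hG : Continuous G) (hH : Continuous H) {M L : ℝ}
    (hL : 2 ≤ L) (h0 : ∀ u, 0 ≤ G u) (hGH : ∀ u, G u ≤ H u) (hHM : ∀ u, H u ≤ M)
    (hbulk : ∀ u, |u| ≤ L / 2 - 1 → G u = H u) (hoff : ∀ u, L / 2 ≤ |u| → G u = 0) :
    |(∫ u, G u) - ∫ u in (-(L / 2))..(L / 2), H u| ≤ 2 * M := by
  have hM0 : 0 ≤ M := (h0 0).trans ((hGH 0).trans (hHM 0))
  -- `∫_ℝ G = ∫_{−L/2}^{L/2} G`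
  have hzero : ∀ u ∉ Icc (-(L / 2)) (L / 2), G u = 0 := by
    intro u hu
    apply hoff
    rw [mem_Icc, not_and_or, not_le, not_le] at hu
    rcases hu with hu | hu
    · rw [abs_of_neg (by linarith)]; linarith
    · rw [abs_of_pos (by linarith)]; linarith
  have hG1 : (∫ u, G u) = ∫ u in (-(L / 2))..(L / 2), G u := by
    rw [← setIntegral_eq_integral_of_forall_compl_eq_zero hzero, intervalIntegral.integral_of_le
      (by linarith), integral_Icc_eq_integral_Ioc]
  rw [hG1, ← intervalIntegral.integral_sub (hG.intervalIntegrable _ _) (hH.intervalIntegrable _ _)]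
  have hi : ∀ a b : ℝ, IntervalIntegrable (fun u ↦ G u - H u) volume a b := fun a b ↦
    (hG.sub hH).intervalIntegrable _ _
  rw [← intervalIntegral.integral_add_adjacent_intervals (hi (-(L / 2)) (-(L / 2) + 1))
    (hi (-(L / 2) + 1) (L / 2)), ← intervalIntegral.integral_add_adjacent_intervals
    (hi (-(L / 2) + 1) (L / 2 - 1)) (hi (L / 2 - 1) (L / 2))]
  have hmid : ∫ u in (-(L / 2) + 1)..(L / 2 - 1), (G u - H u) = 0 := by
    rw [intervalIntegral.integral_congr (g := fun _ ↦ (0 : ℝ)) fun u hu ↦ ?_,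
      intervalIntegral.integral_zero]
    rw [uIcc_of_le (by linarith)] at hu
    dsimp only
    rw [hbulk u (abs_le.2 ⟨by linarith [hu.1], hu.2⟩), sub_self]
  have hpt : ∀ u, |G u - H u| ≤ M := fun u ↦ by
    rw [abs_sub_comm, abs_of_nonneg (sub_nonneg.2 (hGH u))]
    linarith [hHM u, h0 u]
  have hend : ∀ a : ℝ, |∫ u in a..(a + 1), (G u - H u)| ≤ M := by
    intro a
    have h := intervalIntegral.norm_integral_le_of_norm_le_const (a := a) (b := a + 1) (C := M)
      (f := fun u ↦ G u - H u) fun u _ ↦ by rw [Real.norm_eq_abs]; exact hpt u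
    rw [Real.norm_eq_abs, show a + 1 - a = (1 : ℝ) by ring, abs_one, mul_one] at h
    exact h
  have h1 := hend (-(L / 2))
  have h2 := hend (L / 2 - 1)
  rw [show L / 2 - 1 + 1 = L / 2 by ring] at h2
  rw [hmid, zero_add]
  calc |(∫ u in (-(L / 2))..(-(L / 2) + 1), (G u - H u)) + ∫ u in (L / 2 - 1)..(L / 2), (G u - H u)|
      ≤ |∫ u in (-(L / 2))..(-(L / 2) + 1), (G u - H u)| + |∫ u in (L / 2 - 1)..(L / 2), (G u - H u)| :=
        abs_add_le _ _
    _ ≤ M + M := add_le_add h1 h2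
    _ = 2 * M := by ring

/-- **`‖φ_T‖₂² = L∫ψ + O(1)`**: `|∫φ_T² − L∫_{−½}^{½}ψ| ≤ 2M` whenever `ψ ≤ M` on `[−½,½]` and `L ≥ 2`.
[cite: AlpogeFurman2026, Theorem 5.7 (proof: "`‖φ‖₂² = L∫ψ + O_χ(1)`"), p. 11] -/
theorem abs_integral_phi_sq_sub_le (hψ : IsWindow ψ) {M : ℝ}
    (hM : ∀ x ∈ Icc (-(1 / 2 : ℝ)) (1 / 2), ψ x ≤ M) {T : ℝ} (hL : 2 ≤ logHeight T) :
    |(∫ u, phi ψ T u ^ 2) - logHeight T * ∫ v in (-(1 / 2 : ℝ))..(1 / 2), ψ v| ≤ 2 * M := by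
  set L := logHeight T with hLdef
  have hL0 : 0 < L := by linarith
  have h := integral_clamp_comp (ψ := ψ) (fun x ↦ x) hL0
  rw [← h]
  refine abs_integral_sub_bulk_le (hψ.continuous_phi_sq T) (hψ.continuous_clamp L) hL
    (fun u ↦ sq_nonneg _) (fun u ↦ phi_sq_le_clamp hψ T u) (fun u ↦ hM _ (clampHalf_mem _))
    (fun u hu ↦ ?_) (fun u hu ↦ by rw [phi_eq_zero_of_le_abs (by rwa [← hLdef])]; ring)
  have hmem : u / L ∈ Icc (-(1 / 2 : ℝ)) (1 / 2) := by
    have hu' := abs_le.1 hu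
    constructor
    · rw [le_div_iff₀ hL0]; linarith
    · rw [div_le_iff₀ hL0]; linarith
  rw [phi_sq_eq_of_abs_le hψ hL0 hu, clampHalf_of_mem hmem]

/-- **`‖φ_T‖₄⁴ = L∫ψ² + O(1)`**: `|∫φ_T⁴ − L∫_{−½}^{½}ψ²| ≤ 2M²` whenever `ψ ≤ M` on `[−½,½]` and
`L ≥ 2`. [cite: AlpogeFurman2026, Theorem 5.7 (proof: "`‖φ‖₄⁴ = L∫ψ² + O_χ(1)`"), p. 11] -/
theorem abs_integral_phi_pow_four_sub_le (hψ : IsWindow ψ) {M : ℝ}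
    (hM : ∀ x ∈ Icc (-(1 / 2 : ℝ)) (1 / 2), ψ x ≤ M) {T : ℝ} (hL : 2 ≤ logHeight T) :
    |(∫ u, phi ψ T u ^ 4) - logHeight T * ∫ v in (-(1 / 2 : ℝ))..(1 / 2), ψ v ^ 2| ≤ 2 * M ^ 2 := by
  set L := logHeight T with hLdef
  have hL0 : 0 < L := by linarith
  have h := integral_clamp_comp (ψ := ψ) (fun x ↦ x ^ 2) hL0
  rw [← h]
  have hψ0 : ∀ u, 0 ≤ ψ (clampHalf (u / L)) := fun u ↦ (hψ.pos _ (clampHalf_mem _)).le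
  have hcG : Continuous fun u ↦ phi ψ T u ^ 4 := (hψ.continuous_phi T).pow 4
  have hcH : Continuous fun u ↦ ψ (clampHalf (u / L)) ^ 2 := (hψ.continuous_clamp L).pow 2
  refine abs_integral_sub_bulk_le (G := fun u ↦ phi ψ T u ^ 4)
    (H := fun u ↦ ψ (clampHalf (u / L)) ^ 2) hcG hcH hL
    (fun u ↦ by positivity) (fun u ↦ ?_) (fun u ↦ ?_)
    (fun u hu ↦ ?_) (fun u hu ↦ by
      show phi ψ T u ^ 4 = 0
      rw [phi_eq_zero_of_le_abs (by rwa [← hLdef])]; ring)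
  · show phi ψ T u ^ 4 ≤ ψ (clampHalf (u / L)) ^ 2
    have h1 := phi_sq_le_clamp hψ T u
    rw [← hLdef] at h1
    calc phi ψ T u ^ 4 = (phi ψ T u ^ 2) ^ 2 := by ring
      _ ≤ ψ (clampHalf (u / L)) ^ 2 := pow_le_pow_left₀ (sq_nonneg _) h1 2
  · show ψ (clampHalf (u / L)) ^ 2 ≤ M ^ 2
    exact pow_le_pow_left₀ (hψ0 u) (hM _ (clampHalf_mem _)) 2
  · have hmem : u / L ∈ Icc (-(1 / 2 : ℝ)) (1 / 2) := by
      have hu' := abs_le.1 hu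
      constructor
      · rw [le_div_iff₀ hL0]; linarith
      · rw [div_le_iff₀ hL0]; linarith
    show phi ψ T u ^ 4 = ψ (clampHalf (u / L)) ^ 2
    rw [show phi ψ T u ^ 4 = (phi ψ T u ^ 2) ^ 2 by ring, phi_sq_eq_of_abs_le hψ hL0 hu,
      clampHalf_of_mem hmem]

/-! ## §A2. `Φ²` is integrable; `g = φ² ⋆ φ²`; `∫Φ² = 2π∫φ⁴`; the inversion formula (5.12) -/

/-- `Φ_T²` is integrable on `ℝ` (it is continuous and `≤ ϑ² ≤ 2M·ϑ`).
[cite: AlpogeFurman2026, §5.1 eq. (5.4) (p. 7: "`∫ϑ² ≤ 8L`")] -/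
theorem integrable_PhiR_sq (hψ : IsWindow ψ) {T : ℝ} (hL : 1 ≤ logHeight T) :
    Integrable fun x ↦ PhiR ψ T x ^ 2 := by
  obtain ⟨A₀, A₂, hA₀, hA₂, hmaj⟩ := exists_majorant hψ
  have hM : 0 < A₀ * logHeight T := by positivity
  obtain ⟨-, hint, -⟩ := integral_lorentz hM hA₂
  have hdom : ∀ x, |PhiR ψ T x ^ 2| ≤
      2 * (A₀ * logHeight T) * lorentz (A₀ * logHeight T) A₂ x := by
    intro x
    have h1 := (hmaj T hL x).2
    have h2 := lorentz_le_two_mul hM hA₂ x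
    have h0 := (lorentz_pos hM hA₂ x).le
    rw [abs_of_nonneg (sq_nonneg _)]
    have h3 : |PhiR ψ T x| ^ 2 ≤ lorentz (A₀ * logHeight T) A₂ x ^ 2 :=
      pow_le_pow_left₀ (abs_nonneg _) h1 2
    rw [sq_abs] at h3
    nlinarith
  exact (hint.const_mul _).mono' (((continuous_hatR hψ T).2.pow 2).aestronglyMeasurable)
    (Eventually.of_forall fun x ↦ by rw [Real.norm_eq_abs]; exact hdom x)

/-- `∫_ℝ Φ_T² ≤ ∫_ℝ ϑ²`-type bound in the usable form `∫Φ² ≤ 2M·2π√(AM)` for any majorant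
`ϑ_{M,A} ≥ |Φ|`. [cite: AlpogeFurman2026, §5.1 eq. (5.4) (p. 7)] -/
theorem integral_PhiR_sq_le_of_majorant (hψ : IsWindow ψ) {M A : ℝ} (hM : 0 < M) (hA : 0 < A)
    {T : ℝ} (hL : 1 ≤ logHeight T) (hmaj : ∀ x : ℝ, |PhiR ψ T x| ≤ lorentz M A x) :
    ∫ x, PhiR ψ T x ^ 2 ≤ 2 * M * (2 * π * Real.sqrt (A * M)) := by
  obtain ⟨-, hint, hI⟩ := integral_lorentz hM hA
  rw [← hI, ← integral_const_mul]
  refine integral_mono (integrable_PhiR_sq hψ hL) (hint.const_mul _) fun x ↦ ?_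
  have h1 := hmaj x
  have h2 := lorentz_le_two_mul hM hA x
  have h0 := (lorentz_pos hM hA x).le
  have h3 : |PhiR ψ T x| ^ 2 ≤ lorentz M A x ^ 2 := pow_le_pow_left₀ (abs_nonneg _) h1 2
  rw [sq_abs] at h3
  dsimp only
  nlinarith

/-- **[AF26] (5.1), `g := φ² ⋆ φ²`**, as the real function `g(y) = ∫ φ_T(u)² φ_T(y − u)² du`
(`= ∫φ²(u)φ²(u+y)du` as printed, `φ²` being even). [cite: AlpogeFurman2026, §5.1 eq. (5.1) (p. 7)] -/
def gConv (ψ : ℝ → ℝ) (T y : ℝ) : ℝ := ∫ u, phi ψ T u ^ 2 * phi ψ T (y - u) ^ 2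

/-- `g(0) = ∫ φ⁴`. [cite: AlpogeFurman2026, §5.1 (p. 7: "`∫Φ² = 2πg(0) = 2πbL`", `b = L⁻¹∫φ⁴`)] -/
theorem gConv_zero (hψ : IsWindow ψ) (T : ℝ) : gConv ψ T 0 = ∫ u, phi ψ T u ^ 4 := by
  rw [gConv]
  refine integral_congr_ae (Eventually.of_forall fun u ↦ ?_)
  dsimp only
  rw [zero_sub, phi_neg hψ.even]; ring

/-- `g` is even. [cite: AlpogeFurman2026, §5.1 (p. 7: "`g` and `A_φ` are even")] -/
theorem gConv_neg (hψ : IsWindow ψ) (T y : ℝ) : gConv ψ T (-y) = gConv ψ T y := by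
  rw [gConv, gConv, ← integral_neg_eq_self]
  refine integral_congr_ae (Eventually.of_forall fun u ↦ ?_)
  dsimp only
  rw [phi_neg hψ.even, show -y - -u = -(y - u) by ring, phi_neg hψ.even]

/-- `φ_T²` as a complex-valued test function: continuous with compact support.
[cite: AlpogeFurman2026, §2.2 (p. 4)] -/
theorem phiSq_test (hψ : IsWindow ψ) (T : ℝ) :
    Continuous (fun u : ℝ ↦ ((phi ψ T u ^ 2 : ℝ) : ℂ)) ∧
      HasCompactSupport (fun u : ℝ ↦ ((phi ψ T u ^ 2 : ℝ) : ℂ)) :=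
  ⟨Complex.continuous_ofReal.comp (hψ.continuous_phi_sq T),
    (hasCompactSupport_phi_sq ψ T).comp_left Complex.ofReal_zero⟩

/-- `φ² ⋆ φ²` (Mathlib convolution, complex-valued) is `g`. [cite: AlpogeFurman2026, §5.1 eq. (5.1) (p. 7)] -/
theorem weilConv_phiSq (ψ : ℝ → ℝ) (T y : ℝ) :
    weilConv (fun u : ℝ ↦ ((phi ψ T u ^ 2 : ℝ) : ℂ)) (fun u : ℝ ↦ ((phi ψ T u ^ 2 : ℝ) : ℂ)) y =
      (gConv ψ T y : ℂ) := by
  rw [weilConv_apply, gConv, ← integral_complex_ofReal]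
  refine integral_congr_ae (Eventually.of_forall fun u ↦ ?_)
  push_cast
  ring

/-- `φ² ⋆ φ²` is continuous with compact support. [cite: AlpogeFurman2026, §5.1 (p. 7: "`g` even, continuous, compactly supported")] -/
theorem gConv_test (hψ : IsWindow ψ) (T : ℝ) :
    Continuous (weilConv (fun u : ℝ ↦ ((phi ψ T u ^ 2 : ℝ) : ℂ)) (fun u : ℝ ↦ ((phi ψ T u ^ 2 : ℝ) : ℂ))) ∧
      HasCompactSupport (weilConv (fun u : ℝ ↦ ((phi ψ T u ^ 2 : ℝ) : ℂ))
        (fun u : ℝ ↦ ((phi ψ T u ^ 2 : ℝ) : ℂ))) := by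
  obtain ⟨hc, hs⟩ := phiSq_test hψ T
  unfold weilConv
  exact ⟨hs.continuous_convolution_right _ hc.locallyIntegrable hc, hs.convolution _ hs⟩

/-- On the critical line the Weil–Mellin transform is the Fourier transform: `ĝ(½+iy) = (hat g)(−y)`.
[cite: AlpogeFurman2026, §1.7 (p. 3: "`f̂(ξ) := ∫f(u)e^{−iuξ}du`")] -/
theorem weilMellin_half_eq_hat (f : ℝ → ℂ) (y : ℝ) :
    weilMellin f (1 / 2 + y * I) = hat f (-(y : ℂ)) := by
  simp only [weilMellin, hat]
  refine integral_congr_ae (Eventually.of_forall fun t ↦ ?_)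
  dsimp only
  congr 2
  ring

/-- `(φ_T²)^(½+iy) = Φ_T(y)`. [cite: AlpogeFurman2026, §5.1 eq. (5.1) (p. 7)] -/
theorem weilMellin_phiSq_half (hψ : IsWindow ψ) (T y : ℝ) :
    weilMellin (fun u : ℝ ↦ ((phi ψ T u ^ 2 : ℝ) : ℂ)) (1 / 2 + y * I) = (PhiR ψ T y : ℂ) := by
  rw [weilMellin_half_eq_hat, show -(y : ℂ) = ((-y : ℝ) : ℂ) by push_cast; ring,
    hat_phi_sq_ofReal hψ.even, PhiR_neg hψ.even]

/-- `(φ² ⋆ φ²)^(½+iy) = Φ(y)²` ("`Φ² = ĝ` on `ℝ`"). [cite: AlpogeFurman2026, §5.1 (p. 7)] -/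
theorem weilMellin_gConv_half (hψ : IsWindow ψ) (T y : ℝ) :
    weilMellin (weilConv (fun u : ℝ ↦ ((phi ψ T u ^ 2 : ℝ) : ℂ)) (fun u : ℝ ↦ ((phi ψ T u ^ 2 : ℝ) : ℂ)))
        (1 / 2 + y * I) = ((PhiR ψ T y ^ 2 : ℝ) : ℂ) := by
  obtain ⟨hc, hs⟩ := phiSq_test hψ T
  rw [weilMellin_weilConv_holds hc hs hc hs, weilMellin_phiSq_half hψ]
  push_cast
  ring

/-- **`∫_ℝ Φ² = 2π ∫ φ⁴`** (Plancherel for `φ²`, as Mellin inversion of `g = φ² ⋆ φ²` at `0`).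
[cite: AlpogeFurman2026, §5.1 (p. 7: "`∫_ℝΦ² = 2πg(0) = 2πbL`")] -/
theorem integral_PhiR_sq (hψ : IsWindow ψ) {T : ℝ} (hL : 1 ≤ logHeight T) :
    ∫ x, PhiR ψ T x ^ 2 = 2 * π * ∫ u, phi ψ T u ^ 4 := by
  obtain ⟨hgc, hgs⟩ := gConv_test hψ T
  have hI : Integrable fun y : ℝ ↦ weilMellin (weilConv (fun u : ℝ ↦ ((phi ψ T u ^ 2 : ℝ) : ℂ))
      (fun u : ℝ ↦ ((phi ψ T u ^ 2 : ℝ) : ℂ))) (1 / 2 + y * I) := by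
    simp_rw [weilMellin_gConv_half hψ]
    exact (integrable_PhiR_sq hψ hL).ofReal
  have h := integral_weilMellin_half hgc hgs hI
  simp_rw [weilMellin_gConv_half hψ] at h
  rw [integral_complex_ofReal, weilConv_phiSq, gConv_zero hψ] at h
  exact_mod_cast h

/-- **[AF26] (5.12)**: `∫_ℝ Φ(x)² cos(xy) dx = 2π g(y)` (the real part of
"`∫Φ(x)²e^{ixy}dx = 2πg(y)`"). [cite: AlpogeFurman2026, §5.3 eq. (5.12) (p. 9)] -/
theorem integral_PhiR_sq_mul_cos (hψ : IsWindow ψ) {T : ℝ} (hL : 1 ≤ logHeight T) (y : ℝ) :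
    ∫ x, PhiR ψ T x ^ 2 * Real.cos (x * y) = 2 * π * gConv ψ T y := by
  obtain ⟨hgc, hgs⟩ := gConv_test hψ T
  have hI : Integrable fun t : ℝ ↦ weilMellin (weilConv (fun u : ℝ ↦ ((phi ψ T u ^ 2 : ℝ) : ℂ))
      (fun u : ℝ ↦ ((phi ψ T u ^ 2 : ℝ) : ℂ))) (1 / 2 + t * I) := by
    simp_rw [weilMellin_gConv_half hψ]
    exact (integrable_PhiR_sq hψ hL).ofReal
  have h := integral_weilMellin_half_mul_cos hgc hgs hI y
  simp_rw [weilMellin_gConv_half hψ] at h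
  rw [weilConv_phiSq, weilConv_phiSq, gConv_neg hψ] at h
  have e : (fun t : ℝ ↦ ((PhiR ψ T t ^ 2 : ℝ) : ℂ) * ((2 * Real.cos (t * y) : ℝ) : ℂ)) =
      fun t : ℝ ↦ ((2 * (PhiR ψ T t ^ 2 * Real.cos (t * y)) : ℝ) : ℂ) := by
    funext t; push_cast; ring
  rw [e, integral_complex_ofReal, integral_const_mul] at h
  have h' : ((2 * ∫ x, PhiR ψ T x ^ 2 * Real.cos (x * y) : ℝ) : ℂ) =
      ((2 * (2 * π * gConv ψ T y) : ℝ) : ℂ) := by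
    rw [h]; push_cast; ring
  have := Complex.ofReal_injective h'
  linarith

/-! ## §A3. The bilinear form `𝓜[u₁,u₂]` -/

/-- **[AF26] §5.3, the bilinear form** `𝓜[u₁,u₂] := ∬_{I×I} Φ(τ−τ′)² u₁(τ) u₂(τ′) dτ dτ′`
(`I = [T,2T]`), as an iterated interval integral with `τ′` outside — the same shape as `formM`, so
that `𝓜 = 𝓜[ν_X,ν_X]` definitionally (`formM_eq_formB`). [cite: AlpogeFurman2026, §5.3, display before (5.11) (p. 9)] -/
def formB (ψ : ℝ → ℝ) (T : ℝ) (u₁ u₂ : ℝ → ℝ) : ℝ :=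
  ∫ τ' in T..2 * T, u₂ τ' * ∫ τ in T..2 * T, PhiR ψ T (τ - τ') ^ 2 * u₁ τ

/-- `𝓜 = 𝓜[ν_X, ν_X]`. [cite: AlpogeFurman2026, §5.3 eq. (5.11) (p. 9)] -/
theorem formM_eq_formB (ψ : ℝ → ℝ) (T : ℝ) :
    formM ψ T = formB ψ T (weilDensity (T / (2 * π))) (weilDensity (T / (2 * π))) := rfl

/-- The inner integral `τ′ ↦ ∫_I Φ(τ−τ′)² u(τ) dτ` is continuous (continuous integrand on a compact
interval). [cite: AlpogeFurman2026, §5.3 (p. 9)] -/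
theorem continuous_formInner (hψ : IsWindow ψ) (T : ℝ) {u : ℝ → ℝ} (hu : Continuous u) :
    Continuous fun τ' : ℝ ↦ ∫ τ in T..2 * T, PhiR ψ T (τ - τ') ^ 2 * u τ := by
  refine intervalIntegral.continuous_parametric_intervalIntegral_of_continuous' ?_ T (2 * T)
  exact (((continuous_hatR hψ T).2.comp (continuous_snd.sub continuous_fst)).pow 2).mul
    (hu.comp continuous_snd)

/-- The integrand `τ ↦ Φ(τ−τ′)² u(τ)` is continuous. [cite: AlpogeFurman2026, §5.3 (p. 9)] -/
theorem continuous_formIntegrand (hψ : IsWindow ψ) (T τ' : ℝ) {u : ℝ → ℝ} (hu : Continuous u) :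
    Continuous fun τ : ℝ ↦ PhiR ψ T (τ - τ') ^ 2 * u τ :=
  (((continuous_hatR hψ T).2.comp (continuous_id.sub continuous_const)).pow 2).mul hu

/-- Additivity in the first slot. [cite: AlpogeFurman2026, §5.3 (p. 9: "a symmetric bilinear form")] -/
theorem formB_add_left (hψ : IsWindow ψ) (T : ℝ) {u v w : ℝ → ℝ} (hu : Continuous u)
    (hv : Continuous v) (hw : Continuous w) :
    formB ψ T (fun τ ↦ u τ + v τ) w = formB ψ T u w + formB ψ T v w := by
  unfold formB
  have e : ∀ τ' : ℝ, ∫ τ in T..2 * T, PhiR ψ T (τ - τ') ^ 2 * (u τ + v τ) =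
      (∫ τ in T..2 * T, PhiR ψ T (τ - τ') ^ 2 * u τ) + ∫ τ in T..2 * T, PhiR ψ T (τ - τ') ^ 2 * v τ := by
    intro τ'
    rw [← intervalIntegral.integral_add ((continuous_formIntegrand hψ T τ' hu).intervalIntegrable _ _)
      ((continuous_formIntegrand hψ T τ' hv).intervalIntegrable _ _)]
    refine intervalIntegral.integral_congr fun τ _ ↦ ?_
    ring
  simp_rw [e, mul_add]
  exact intervalIntegral.integral_add ((hw.mul (continuous_formInner hψ T hu)).intervalIntegrable _ _)
    ((hw.mul (continuous_formInner hψ T hv)).intervalIntegrable _ _)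

/-- Additivity in the second slot. [cite: AlpogeFurman2026, §5.3 (p. 9: "a symmetric bilinear form")] -/
theorem formB_add_right (hψ : IsWindow ψ) (T : ℝ) {u v w : ℝ → ℝ} (hu : Continuous u)
    (hv : Continuous v) (hw : Continuous w) :
    formB ψ T u (fun τ ↦ v τ + w τ) = formB ψ T u v + formB ψ T u w := by
  unfold formB
  simp_rw [add_mul]
  exact intervalIntegral.integral_add ((hv.mul (continuous_formInner hψ T hu)).intervalIntegrable _ _)
    ((hw.mul (continuous_formInner hψ T hu)).intervalIntegrable _ _)

/-- Homogeneity in the first slot. [cite: AlpogeFurman2026, §5.3 (p. 9: "a symmetric bilinear form")] -/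
theorem formB_const_mul_left (ψ : ℝ → ℝ) (T c : ℝ) (u w : ℝ → ℝ) :
    formB ψ T (fun τ ↦ c * u τ) w = c * formB ψ T u w := by
  unfold formB
  have e : ∀ τ' : ℝ, ∫ τ in T..2 * T, PhiR ψ T (τ - τ') ^ 2 * (c * u τ) =
      c * ∫ τ in T..2 * T, PhiR ψ T (τ - τ') ^ 2 * u τ := by
    intro τ'
    rw [← intervalIntegral.integral_const_mul]
    refine intervalIntegral.integral_congr fun τ _ ↦ ?_
    ring
  simp_rw [e]
  rw [← intervalIntegral.integral_const_mul]
  refine intervalIntegral.integral_congr fun τ' _ ↦ ?_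
  ring

/-- Homogeneity in the second slot. [cite: AlpogeFurman2026, §5.3 (p. 9: "a symmetric bilinear form")] -/
theorem formB_const_mul_right (ψ : ℝ → ℝ) (T c : ℝ) (u w : ℝ → ℝ) :
    formB ψ T u (fun τ ↦ c * w τ) = c * formB ψ T u w := by
  unfold formB
  rw [← intervalIntegral.integral_const_mul]
  refine intervalIntegral.integral_congr fun τ' _ ↦ ?_
  ring

/-- Subtraction in the first slot. [cite: AlpogeFurman2026, §5.3 (p. 9: "a symmetric bilinear form")] -/
theorem formB_sub_left (hψ : IsWindow ψ) (T : ℝ) {u v w : ℝ → ℝ} (hu : Continuous u)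
    (hv : Continuous v) (hw : Continuous w) :
    formB ψ T (fun τ ↦ u τ - v τ) w = formB ψ T u w - formB ψ T v w := by
  have h := formB_add_left hψ T (u := fun τ ↦ u τ - v τ) (v := v) (w := w) (hu.sub hv) hv hw
  simp only [sub_add_cancel] at h
  linarith

/-- Subtraction in the second slot. [cite: AlpogeFurman2026, §5.3 (p. 9: "a symmetric bilinear form")] -/
theorem formB_sub_right (hψ : IsWindow ψ) (T : ℝ) {u v w : ℝ → ℝ} (hu : Continuous u)
    (hv : Continuous v) (hw : Continuous w) :
    formB ψ T u (fun τ ↦ v τ - w τ) = formB ψ T u v - formB ψ T u w := by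
  have h := formB_add_right hψ T (u := u) (v := fun τ ↦ v τ - w τ) (w := w) hu (hv.sub hw) hw
  simp only [sub_add_cancel] at h
  linarith

/-- **Symmetry** `𝓜[u,v] = 𝓜[v,u]` ("`Φ²` is even"; Fubini on `I × I`).
[cite: AlpogeFurman2026, §5.3 (p. 9: "a symmetric bilinear form (`Φ²` is even)")] -/
theorem formB_comm (hψ : IsWindow ψ) {T : ℝ} (hT : 0 < T) {u v : ℝ → ℝ} (hu : Continuous u)
    (hv : Continuous v) : formB ψ T u v = formB ψ T v u := by
  have hT2 : T ≤ 2 * T := by linarith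
  have hΦ := (continuous_hatR hψ T).2
  unfold formB
  simp_rw [intervalIntegral.integral_of_le hT2]
  have e1 : ∀ τ' : ℝ, v τ' * ∫ τ in Ioc T (2 * T), PhiR ψ T (τ - τ') ^ 2 * u τ =
      ∫ τ in Ioc T (2 * T), v τ' * (PhiR ψ T (τ - τ') ^ 2 * u τ) := fun τ' ↦
    (integral_const_mul _ _).symm
  have e2 : ∀ τ : ℝ, u τ * ∫ τ' in Ioc T (2 * T), PhiR ψ T (τ' - τ) ^ 2 * v τ' =
      ∫ τ' in Ioc T (2 * T), v τ' * (PhiR ψ T (τ - τ') ^ 2 * u τ) := by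
    intro τ
    rw [← integral_const_mul]
    refine integral_congr_ae (Eventually.of_forall fun τ' ↦ ?_)
    dsimp only
    rw [show τ' - τ = -(τ - τ') by ring, PhiR_neg hψ.even]
    ring
  simp_rw [e1]
  rw [integral_integral_swap]
  · simp_rw [e2]
  · -- integrability on the product
    set F : ℝ → ℝ → ℝ := fun τ' τ ↦ v τ' * (PhiR ψ T (τ - τ') ^ 2 * u τ) with hF
    have hc : Continuous (Function.uncurry F) := by
      rw [hF]
      exact (hv.comp continuous_fst).mul
        (((hΦ.comp (continuous_snd.sub continuous_fst)).pow 2).mul (hu.comp continuous_snd))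
    rw [Measure.prod_restrict]
    have hK : IsCompact (Icc T (2 * T) ×ˢ Icc T (2 * T)) := isCompact_Icc.prod isCompact_Icc
    have hI : IntegrableOn (Function.uncurry F) (Icc T (2 * T) ×ˢ Icc T (2 * T))
        ((volume : Measure ℝ).prod volume) := by
      have := hc.continuousOn.integrableOn_compact (μ := (volume : Measure (ℝ × ℝ))) hK
      exact this
    exact hI.mono_set (Set.prod_mono Ioc_subset_Icc_self Ioc_subset_Icc_self)

/-- **The sup bound**: if `|u₁| ≤ M₁` and `|u₂| ≤ M₂` on `I = [T,2T]` then
`|𝓜[u₁,u₂]| ≤ M₁ M₂ · T · ∫_ℝ Φ²` ("`sup_τ ∫_I Φ(τ−τ′)² dτ′ ≤ ∫Φ²` … inserting these sup bounds into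
the definition of `𝓜[·,·]` (an integral over a region of `τ′`-length `T`)").
[cite: AlpogeFurman2026, Proposition 5.5 (proof, last sentence), p. 10] -/
theorem abs_formB_le (hψ : IsWindow ψ) {T : ℝ} (hT : 0 < T) (hL : 1 ≤ logHeight T)
    {u₁ u₂ : ℝ → ℝ} (hu₁ : Continuous u₁) (hu₂ : Continuous u₂) {M₁ M₂ : ℝ}
    (h₁ : ∀ τ ∈ Icc T (2 * T), |u₁ τ| ≤ M₁) (h₂ : ∀ τ ∈ Icc T (2 * T), |u₂ τ| ≤ M₂) :
    |formB ψ T u₁ u₂| ≤ M₁ * M₂ * T * ∫ x, PhiR ψ T x ^ 2 := by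
  set F := ∫ x, PhiR ψ T x ^ 2 with hFdef
  have hT2 : T ≤ 2 * T := by linarith
  have hM₁ : 0 ≤ M₁ := (abs_nonneg _).trans (h₁ T ⟨le_rfl, hT2⟩)
  have hM₂ : 0 ≤ M₂ := (abs_nonneg _).trans (h₂ T ⟨le_rfl, hT2⟩)
  have hΦi := integrable_PhiR_sq hψ hL
  have hΦ := (continuous_hatR hψ T).2
  -- the inner integral
  have hinner : ∀ τ' : ℝ, |∫ τ in T..2 * T, PhiR ψ T (τ - τ') ^ 2 * u₁ τ| ≤ M₁ * F := by
    intro τ'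
    have hshift : ∫ τ in T..2 * T, PhiR ψ T (τ - τ') ^ 2 ≤ F := by
      rw [intervalIntegral.integral_of_le hT2]
      calc ∫ τ in Ioc T (2 * T), PhiR ψ T (τ - τ') ^ 2 ≤ ∫ τ, PhiR ψ T (τ - τ') ^ 2 :=
            setIntegral_le_integral (hΦi.comp_sub_right τ')
              (Eventually.of_forall fun τ ↦ sq_nonneg _)
        _ = F := integral_sub_right_eq_self (fun x ↦ PhiR ψ T x ^ 2) τ'
    calc |∫ τ in T..2 * T, PhiR ψ T (τ - τ') ^ 2 * u₁ τ|
        ≤ ∫ τ in T..2 * T, |PhiR ψ T (τ - τ') ^ 2 * u₁ τ| :=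
          intervalIntegral.abs_integral_le_integral_abs hT2
      _ ≤ ∫ τ in T..2 * T, PhiR ψ T (τ - τ') ^ 2 * M₁ := by
          refine intervalIntegral.integral_mono_on hT2
            ((continuous_formIntegrand hψ T τ' hu₁).abs.intervalIntegrable _ _)
            ((continuous_formIntegrand hψ T τ' continuous_const).intervalIntegrable _ _)
            fun τ hτ ↦ ?_
          rw [abs_mul, abs_of_nonneg (sq_nonneg _)]
          exact mul_le_mul_of_nonneg_left (h₁ τ hτ) (sq_nonneg _)
      _ = M₁ * ∫ τ in T..2 * T, PhiR ψ T (τ - τ') ^ 2 := by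
          rw [intervalIntegral.integral_mul_const, mul_comm]
      _ ≤ M₁ * F := mul_le_mul_of_nonneg_left hshift hM₁
  -- the outer integral
  unfold formB
  calc |∫ τ' in T..2 * T, u₂ τ' * ∫ τ in T..2 * T, PhiR ψ T (τ - τ') ^ 2 * u₁ τ|
      ≤ ∫ τ' in T..2 * T, |u₂ τ' * ∫ τ in T..2 * T, PhiR ψ T (τ - τ') ^ 2 * u₁ τ| :=
        intervalIntegral.abs_integral_le_integral_abs hT2
    _ ≤ ∫ _ in T..2 * T, M₂ * (M₁ * F) := by
        refine intervalIntegral.integral_mono_on hT2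
          ((hu₂.mul (continuous_formInner hψ T hu₁)).abs.intervalIntegrable _ _)
          (continuous_const.intervalIntegrable _ _) fun τ' hτ' ↦ ?_
        rw [abs_mul]
        exact mul_le_mul (h₂ τ' hτ') (hinner τ') (abs_nonneg _) hM₂
    _ = M₁ * M₂ * T * F := by
        rw [intervalIntegral.integral_const, smul_eq_mul]; ring

/-! ## §A4. Pointwise bounds for the densities on the window `I = [T,2T]` -/

/-- `exp((log X)/2) = √X` for `X > 0`. [folklore] -/
private theorem exp_log_half {X : ℝ} (hX : 0 < X) : Real.exp (Real.log X / 2) = Real.sqrt X := by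
  rw [Real.sqrt_eq_rpow, Real.rpow_def_of_pos hX]; ring_nf

/-- **`|Π_X(τ)| ≤ 1/√T` on `I`** (`X = T/2π`, `T ≥ 2π`): `|X^{½+iτ}/(½+iτ)| ≤ √X/τ ≤ √X/T`.
(The printed "`|Π_X| ≤ 3√X/T` on `I`".) [cite: AlpogeFurman2026, Proposition 5.5 (proof: "on `I` we have `|Π_X| ≤ 3√X/T`"), p. 10] -/
theorem abs_polarDensity_le_window {T : ℝ} (hT : 2 * π ≤ T) {τ : ℝ} (hτ : τ ∈ Icc T (2 * T)) :
    |polarDensity (T / (2 * π)) τ| ≤ 1 / Real.sqrt T := by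
  have hπ := Real.pi_gt_three
  have hT0 : 0 < T := by linarith
  have hτ0 : 0 < τ := by linarith [hτ.1]
  set X := T / (2 * π) with hX
  have hX0 : 0 < X := by positivity
  have hXT : X ≤ T := by rw [hX, div_le_iff₀ (by positivity)]; nlinarith
  have hnum : ‖cexp ((1 / 2 + τ * I) * (Real.log X : ℂ))‖ = Real.sqrt X := by
    rw [Complex.norm_exp]
    have hre : ((1 / 2 + τ * I) * (Real.log X : ℂ)).re = Real.log X / 2 := by
      simp [Complex.mul_re]; ring
    rw [hre, exp_log_half hX0]
  have hden : τ ≤ ‖(1 / 2 : ℂ) + τ * I‖ := by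
    have h := Complex.abs_im_le_norm ((1 / 2 : ℂ) + τ * I)
    have him : ((1 / 2 : ℂ) + τ * I).im = τ := by simp
    rw [him, abs_of_pos hτ0] at h
    exact h
  have hk : ‖polarKernel X τ‖ ≤ Real.sqrt X / T := by
    unfold polarKernel
    rw [norm_div, hnum]
    exact div_le_div_of_nonneg_left (Real.sqrt_nonneg _) hT0 (hτ.1.trans hden)
  have hre := (Complex.abs_re_le_norm (polarKernel X τ)).trans hk
  have hsX : Real.sqrt X ≤ Real.sqrt T := Real.sqrt_le_sqrt hXT
  have hsT : 0 < Real.sqrt T := Real.sqrt_pos.2 hT0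
  unfold polarDensity
  rw [abs_mul, abs_of_pos (by positivity : (0 : ℝ) < 1 / π)]
  calc 1 / π * |(polarKernel X τ).re| ≤ 1 / 3 * (Real.sqrt T / T) := by
        refine mul_le_mul ?_ (hre.trans (by gcongr)) (abs_nonneg _) (by norm_num)
        exact one_div_le_one_div_of_le (by norm_num) hπ.le
    _ = 1 / 3 * (1 / Real.sqrt T) := by rw [Real.sqrt_div_self']
    _ ≤ 1 / Real.sqrt T := by
        have : 0 < 1 / Real.sqrt T := by positivity
        linarith

/-- **`|P_X(τ)| ≤ (log 4 + 4)√T`** for all `τ` (`X = T/2π`, `T ≥ 4π`): the printed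
"`|P_X| ≤ (1/π)Σ_{n≤X}Λ(n)/√n ≪ √X`", with the tree's Chebyshev constant.
[cite: AlpogeFurman2026, §2.1 eq. (2.4) and Lemma 5.1 eq. (5.5) (pp. 4, 7)] -/
theorem abs_primeDensity_le_window {T : ℝ} (hT : 4 * π ≤ T) (τ : ℝ) :
    |primeDensity (T / (2 * π)) τ| ≤ (Real.log 4 + 4) * Real.sqrt T := by
  have hπ := Real.pi_gt_three
  have hT0 : 0 < T := by linarith
  set X := T / (2 * π) with hX
  have hX2 : 2 ≤ X := by rw [hX, le_div_iff₀ (by positivity)]; linarith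
  have hXT : X ≤ T := by rw [hX, div_le_iff₀ (by positivity)]; nlinarith
  have hlog4 : 0 ≤ Real.log 4 := Real.log_nonneg (by norm_num)
  have h := abs_primeDensity_le X τ
  rw [Finset.range_eq_Ico, Finset.Ico_add_one_right_eq_Icc] at h
  have h2 := sum_vonMangoldt_div_sqrt_le hX2
  have hsX : Real.sqrt X ≤ Real.sqrt T := Real.sqrt_le_sqrt hXT
  refine h.trans ?_
  calc 1 / π * ∑ n ∈ Finset.Icc 0 ⌊X⌋₊, (Λ n : ℝ) / Real.sqrt n
      ≤ 1 / 3 * (2 * (Real.log 4 + 4) * Real.sqrt X) := by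
        refine mul_le_mul ?_ h2 (Finset.sum_nonneg fun n _ ↦ div_nonneg
          ArithmeticFunction.vonMangoldt_nonneg (Real.sqrt_nonneg _)) (by norm_num)
        exact one_div_le_one_div_of_le (by norm_num) hπ.le
    _ ≤ 1 / 3 * (2 * (Real.log 4 + 4) * Real.sqrt T) := by gcongr
    _ ≤ (Real.log 4 + 4) * Real.sqrt T := by nlinarith [Real.sqrt_nonneg T]

/-- **`μ(τ) = (1/2π) log(τ/2π) + O(1/τ)`**: `|μ(τ) − (1/2π)log(τ/2π)| ≤ 1/τ` for `τ ≥ 1` (Gauss's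
formula for `Re Γ′/Γ(¼ + iτ/2)` via the tree's `abs_re_digamma_sub_log_norm_le`, and
`0 ≤ log|¼+iτ/2| − log(τ/2) ≤ 1/(8τ²)`). The printed (2.3): "`μ(τ) = (1/2π)log(|τ|/2π) + O(τ⁻²)`".
[cite: AlpogeFurman2026, §2.1 eq. (2.3) (p. 4)] -/
theorem abs_archDensity_sub_log_le {τ : ℝ} (hτ : 1 ≤ τ) :
    |archDensity τ - 1 / (2 * π) * Real.log (τ / (2 * π))| ≤ 1 / τ := by
  have hπ := Real.pi_gt_three
  have hπ4 := Real.pi_lt_d2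
  have hτ0 : 0 < τ := by linarith
  set w : ℂ := 1 / 4 + τ / 2 * I with hw
  have hre : w.re = 1 / 4 := by simp [hw]
  have him : w.im = τ / 2 := by simp [hw]
  have hn2 : ‖w‖ ^ 2 = 1 / 16 + τ ^ 2 / 4 := by
    rw [Complex.sq_norm, Complex.normSq_apply, hre, him]; ring
  have hnge : τ / 2 ≤ ‖w‖ := by
    have h := Complex.abs_im_le_norm w
    rw [him, abs_of_pos (by positivity)] at h
    exact h
  have hnpos : 0 < ‖w‖ := by linarith
  -- Gauss's formula
  have hG := Literature.Analysis.SpecialFunctions.Complex.abs_re_digamma_sub_log_norm_le (w := w)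
    (by rw [hre]; norm_num) (by rw [him]; positivity)
  rw [him, abs_of_pos (by positivity : (0 : ℝ) < τ / 2)] at hG
  have h1 : 1 / (2 * ‖w‖ ^ 2) + π / (4 * (τ / 2)) ≤ 2 / τ + π / (2 * τ) := by
    have ha : 1 / (2 * ‖w‖ ^ 2) ≤ 2 / τ := by
      rw [div_le_div_iff₀ (by positivity) hτ0, hn2]
      nlinarith
    have hb : π / (4 * (τ / 2)) = π / (2 * τ) := by ring
    linarith [hb.le, hb.ge]
  -- the norm against `τ/2`
  have h2 : 0 ≤ Real.log ‖w‖ - Real.log (τ / 2) ∧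
      Real.log ‖w‖ - Real.log (τ / 2) ≤ 1 / (8 * τ) := by
    rw [← Real.log_div hnpos.ne' (by positivity)]
    have hr1 : 1 ≤ ‖w‖ / (τ / 2) := by rw [le_div_iff₀ (by positivity)]; linarith
    refine ⟨Real.log_nonneg hr1, ?_⟩
    have hlog := Real.log_le_sub_one_of_pos (by positivity : 0 < ‖w‖ / (τ / 2))
    have h2w : 2 * ‖w‖ ≤ τ + 1 / (8 * τ) := by
      have hsq : (2 * ‖w‖) ^ 2 ≤ (τ + 1 / (8 * τ)) ^ 2 := by
        have e1 : (2 * ‖w‖) ^ 2 = 1 / 4 + τ ^ 2 := by rw [mul_pow, hn2]; ring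
        have e2 : (τ + 1 / (8 * τ)) ^ 2 = τ ^ 2 + 1 / 4 + (1 / (8 * τ)) ^ 2 := by
          field_simp
          ring
        rw [e1, e2]
        nlinarith [sq_nonneg (1 / (8 * τ))]
      exact (pow_le_pow_iff_left₀ (by positivity) (by positivity) two_ne_zero).1 hsq
    have e3 : ‖w‖ / (τ / 2) - 1 = (2 * ‖w‖ - τ) / τ := by field_simp
    rw [e3] at hlog
    have h4 : (2 * ‖w‖ - τ) / τ ≤ (1 / (8 * τ)) / τ :=
      div_le_div_of_nonneg_right (by linarith) hτ0.le
    have h5 : (1 / (8 * τ)) / τ ≤ 1 / (8 * τ) := div_le_self (by positivity) hτ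
    linarith
  -- assemble
  have e : archDensity τ - 1 / (2 * π) * Real.log (τ / (2 * π)) =
      1 / (2 * π) * (((digamma w).re - Real.log ‖w‖) + (Real.log ‖w‖ - Real.log (τ / 2))) := by
    rw [archDensity, Real.log_div hτ0.ne' (by positivity), Real.log_div hτ0.ne' two_ne_zero,
      Real.log_mul two_ne_zero Real.pi_pos.ne']
    ring
  rw [e, abs_mul, abs_of_pos (by positivity : (0 : ℝ) < 1 / (2 * π))]
  have htot : |((digamma w).re - Real.log ‖w‖) + (Real.log ‖w‖ - Real.log (τ / 2))| ≤
      2 / τ + π / (2 * τ) + 1 / (8 * τ) := by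
    refine (abs_add_le _ _).trans (add_le_add (hG.trans h1) ?_)
    rw [abs_of_nonneg h2.1]
    exact h2.2
  have hc : 1 / (2 * π) * (2 + π / 2 + 1 / 8) ≤ 1 := by
    rw [div_mul_eq_mul_div, one_mul, div_le_one (by positivity)]
    linarith
  calc 1 / (2 * π) * |((digamma w).re - Real.log ‖w‖) + (Real.log ‖w‖ - Real.log (τ / 2))|
      ≤ 1 / (2 * π) * (2 / τ + π / (2 * τ) + 1 / (8 * τ)) := by gcongr
    _ = (1 / (2 * π) * (2 + π / 2 + 1 / 8)) * (1 / τ) := by field_simp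
    _ ≤ 1 * (1 / τ) := by gcongr
    _ = 1 / τ := one_mul _

/-- **On `I`: `|μ(τ) − L/2π| ≤ 1/2`** (`L = log(T/2π)`, `T ≥ 300`; `(1/2π)log(τ/T) ∈ [0, (log 2)/2π]`).
[cite: AlpogeFurman2026, Proposition 5.3 (proof: "`μ(τ) = μ(τ′) + O(|τ−τ′|/T)`, `0 < μ ≤ l` on `I`"), p. 9] -/
theorem abs_archDensity_sub_le_window {T : ℝ} (hT : 300 ≤ T) {τ : ℝ} (hτ : τ ∈ Icc T (2 * T)) :
    |archDensity τ - logHeight T / (2 * π)| ≤ 1 / 2 := by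
  have hπ := Real.pi_gt_three
  have hT0 : 0 < T := by linarith
  have hτ1 : 1 ≤ τ := by linarith [hτ.1]
  have hτ0 : 0 < τ := by linarith
  have h1 := abs_archDensity_sub_log_le hτ1
  have h2 : Real.log (τ / (2 * π)) = logHeight T + Real.log (τ / T) := by
    rw [logHeight, ← Real.log_mul (by positivity) (by positivity)]
    congr 1
    field_simp
  have h3 : 0 ≤ Real.log (τ / T) := Real.log_nonneg (by rw [le_div_iff₀ hT0]; linarith [hτ.1])
  have h4 : Real.log (τ / T) ≤ 1 := by
    have h := Real.log_le_sub_one_of_pos (by positivity : 0 < τ / T)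
    have : τ / T ≤ 2 := by rw [div_le_iff₀ hT0]; exact hτ.2
    linarith
  have e : archDensity τ - logHeight T / (2 * π) =
      (archDensity τ - 1 / (2 * π) * Real.log (τ / (2 * π))) + 1 / (2 * π) * Real.log (τ / T) := by
    rw [h2]; ring
  rw [e]
  refine (abs_add_le _ _).trans ?_
  rw [abs_of_nonneg (by positivity : (0 : ℝ) ≤ 1 / (2 * π) * Real.log (τ / T))]
  have h5 : 1 / τ ≤ 1 / 300 := by
    rw [div_le_div_iff₀ hτ0 (by norm_num)]; linarith [hτ.1]
  have h6 : 1 / (2 * π) * Real.log (τ / T) ≤ 1 / 6 * 1 := by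
    refine mul_le_mul ?_ h4 h3 (by norm_num)
    rw [div_le_div_iff₀ (by positivity) (by norm_num : (0:ℝ) < 6)]; linarith
  linarith

/-- **On `I`: `|μ(τ)| ≤ L`** (`L ≥ 1`, `T ≥ 300`). [cite: AlpogeFurman2026, Proposition 5.5 (proof: "`0 < μ ≤ l`"), p. 10] -/
theorem abs_archDensity_le_window {T : ℝ} (hT : 300 ≤ T) (hL : 1 ≤ logHeight T) {τ : ℝ}
    (hτ : τ ∈ Icc T (2 * T)) : |archDensity τ| ≤ logHeight T := by
  have hπ := Real.pi_gt_three
  have h := abs_archDensity_sub_le_window hT hτ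
  have e : archDensity τ = (archDensity τ - logHeight T / (2 * π)) + logHeight T / (2 * π) := by ring
  rw [e]
  refine (abs_add_le _ _).trans ?_
  rw [abs_of_nonneg (by positivity : (0 : ℝ) ≤ logHeight T / (2 * π))]
  have : logHeight T / (2 * π) ≤ logHeight T / 6 :=
    div_le_div_of_nonneg_left (by linarith) (by norm_num) (by linarith)
  linarith

/-- `L = log(T/2π) ≤ 2√T` and `L ≤ T` (`T > 0`): the length scale `L` of [AF26] §2.2 against `T`.
[cite: AlpogeFurman2026, §2.2 (p. 4: "`L := l = log(T/2π)`")] -/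
theorem logHeight_le_two_sqrt {T : ℝ} (hT : 0 < T) :
    logHeight T ≤ 2 * Real.sqrt T ∧ logHeight T ≤ T := by
  have hπ := Real.pi_gt_three
  have h1 : logHeight T ≤ Real.log T := by
    rw [logHeight]
    refine Real.log_le_log (by positivity) ?_
    rw [div_le_iff₀ (by positivity)]; nlinarith
  have hs := Real.sqrt_pos.2 hT
  have h2 : Real.log T = 2 * Real.log (Real.sqrt T) := by
    rw [Real.log_sqrt hT.le]; ring
  have h3 := Real.log_le_sub_one_of_pos hs
  have h4 : Real.log T ≤ 2 * Real.sqrt T := by rw [h2]; linarith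
  have h5 : Real.sqrt T ≤ T / 2 + 1 / 2 := by
    nlinarith [Real.sq_sqrt hT.le, sq_nonneg (Real.sqrt T - 1)]
  have h6 := Real.log_le_sub_one_of_pos hT
  exact ⟨h1.trans h4, h1.trans (by linarith)⟩

/-! ## §A5. The archimedean term (Proposition 5.3) to precision `O(T L²)` -/

/-- `∫_ℝ f − ∫_{(a,b]} f = ∫_{(−∞,a]} f + ∫_{(b,∞)} f` (`a ≤ b`, `f` integrable): the splitting
"`∫_{I−τ′}Φ² = 2πbL − ∫_{x<T−τ′}Φ² − ∫_{x>2T−τ′}Φ²`" of the proof of Proposition 5.3, for a general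
integrand. [cite: AlpogeFurman2026, Proposition 5.3 (proof), p. 9] -/
theorem integral_sub_setIntegral_Ioc {f : ℝ → ℝ} (hf : Integrable f) {a b : ℝ} (hab : a ≤ b) :
    (∫ x, f x) - ∫ x in Ioc a b, f x = (∫ x in Iic a, f x) + ∫ x in Ioi b, f x := by
  have h1 := intervalIntegral.integral_Iic_add_Ioi (b := a) (f := f) (μ := volume)
    hf.integrableOn hf.integrableOn
  have h2 : ∫ x in Ioi a, f x = (∫ x in Ioc a b, f x) + ∫ x in Ioi b, f x := by
    rw [← setIntegral_union Set.Ioc_disjoint_Ioi_same measurableSet_Ioi hf.integrableOn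
      hf.integrableOn, Set.Ioc_union_Ioi_eq_Ioi hab]
  linarith

/-- **Tails of `Φ²` beyond distance `1`**: `∫_{x>c} Φ² ≤ 4A²/3` and `∫_{x<−c} Φ² ≤ 4A²/3` for `c ≥ 1`
(`Φ² ≤ ϑ²`, `∫_{r>1}ϑ² ≤ 4A²/3`, `Φ` even). [cite: AlpogeFurman2026, Proposition 5.3 (proof: "`∫_{x<T−τ′}Φ²` …"), p. 9] -/
theorem tail_PhiR_sq_le (hψ : IsWindow ψ) {M A : ℝ} (hM : 0 < M) (hA : 0 < A) {T : ℝ}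
    (hL : 1 ≤ logHeight T) (hmaj : ∀ x : ℝ, |PhiR ψ T x| ≤ lorentz M A x) {c : ℝ} (hc : 1 ≤ c) :
    (∫ x in Ioi c, PhiR ψ T x ^ 2) ≤ 4 * A ^ 2 / 3 ∧
      (∫ x in Iic (-c), PhiR ψ T x ^ 2) ≤ 4 * A ^ 2 / 3 := by
  obtain ⟨hint1, -, h1⟩ := setIntegral_lorentz_sq_le hM hA (1 : ℝ)
  have h1' : (∫ r in Ioi (1 : ℝ), lorentz M A r ^ 2) ≤ 4 * A ^ 2 / 3 := by
    have := h1 one_pos; simpa using this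
  have hΦi := integrable_PhiR_sq hψ hL
  have hpt : ∀ x : ℝ, PhiR ψ T x ^ 2 ≤ lorentz M A x ^ 2 := fun x ↦ by
    have := pow_le_pow_left₀ (abs_nonneg _) (hmaj x) 2
    rwa [sq_abs] at this
  have hright : ∀ c : ℝ, 1 ≤ c → (∫ x in Ioi c, PhiR ψ T x ^ 2) ≤ 4 * A ^ 2 / 3 := by
    intro c hc
    calc ∫ x in Ioi c, PhiR ψ T x ^ 2 ≤ ∫ x in Ioi c, lorentz M A x ^ 2 :=
          setIntegral_mono_on hΦi.integrableOn (hint1.mono_set (Ioi_subset_Ioi hc))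
            measurableSet_Ioi fun x _ ↦ hpt x
      _ ≤ ∫ x in Ioi 1, lorentz M A x ^ 2 :=
          setIntegral_mono_set hint1 (Eventually.of_forall fun x ↦ sq_nonneg _)
            (Ioi_subset_Ioi hc).eventuallyLE
      _ ≤ 4 * A ^ 2 / 3 := h1'
  refine ⟨hright c hc, ?_⟩
  have e : ∫ x in Iic (-c), PhiR ψ T x ^ 2 = ∫ x in Ioi c, PhiR ψ T (-x) ^ 2 :=
    (integral_comp_neg_Ioi c (fun x ↦ PhiR ψ T x ^ 2)).symm
  rw [e]
  simp_rw [PhiR_neg hψ.even]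
  exact hright c hc

/-- **`𝓜[1,1] = T∫Φ² + O(T)`**: `|𝓜[1,1] − T·∫_ℝΦ²| ≤ 2∫Φ² + 3A²T` (`T ≥ 2`): for `τ′ ∈ I`,
`∫_I Φ(τ−τ′)² dτ = ∫Φ² − ∫_{x<T−τ′}Φ² − ∫_{x>2T−τ′}Φ²`, the two tails being `≤ ∫Φ²` always and
`≤ 8A²/3` when `τ′ ∈ [T+1, 2T−1]`. [cite: AlpogeFurman2026, Proposition 5.3 (proof: "In the main term, `∫_{I−τ′}Φ² = 2πbL − ∫_{x<T−τ′}Φ² − ∫_{x>2T−τ′}Φ²`"), p. 9] -/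
theorem formB_one_one_sub_le (hψ : IsWindow ψ) {M A : ℝ} (hM : 0 < M) (hA : 0 < A) {T : ℝ}
    (hT : 2 ≤ T) (hL : 1 ≤ logHeight T) (hmaj : ∀ x : ℝ, |PhiR ψ T x| ≤ lorentz M A x) :
    |formB ψ T (fun _ ↦ 1) (fun _ ↦ 1) - T * ∫ x, PhiR ψ T x ^ 2| ≤
      2 * (∫ x, PhiR ψ T x ^ 2) + 3 * A ^ 2 * T := by
  set F := ∫ x, PhiR ψ T x ^ 2 with hFdef
  have hT2 : T ≤ 2 * T := by linarith
  have hΦi := integrable_PhiR_sq hψ hL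
  have hF0 : 0 ≤ F := integral_nonneg fun x ↦ sq_nonneg _
  set inner : ℝ → ℝ := fun τ' ↦ ∫ τ in T..2 * T, PhiR ψ T (τ - τ') ^ 2 * (1 : ℝ) with hinner
  have hinner_eq : ∀ τ' : ℝ, inner τ' = ∫ x in Ioc (T - τ') (2 * T - τ'), PhiR ψ T x ^ 2 := by
    intro τ'
    simp only [hinner, mul_one]
    rw [intervalIntegral.integral_comp_sub_right (fun x ↦ PhiR ψ T x ^ 2) τ',
      intervalIntegral.integral_of_le (by linarith)]
  have hdiff : ∀ τ' : ℝ, F - inner τ' =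
      (∫ x in Iic (T - τ'), PhiR ψ T x ^ 2) + ∫ x in Ioi (2 * T - τ'), PhiR ψ T x ^ 2 := by
    intro τ'
    rw [hinner_eq]
    exact integral_sub_setIntegral_Ioc hΦi (by linarith)
  have hd0 : ∀ τ' : ℝ, 0 ≤ F - inner τ' := fun τ' ↦ by
    rw [hdiff]
    exact add_nonneg (setIntegral_nonneg measurableSet_Iic fun x _ ↦ sq_nonneg _)
      (setIntegral_nonneg measurableSet_Ioi fun x _ ↦ sq_nonneg _)
  have hdF : ∀ τ' : ℝ, F - inner τ' ≤ F := fun τ' ↦ by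
    have : 0 ≤ inner τ' := by
      rw [hinner_eq]; exact setIntegral_nonneg measurableSet_Ioc fun x _ ↦ sq_nonneg _
    linarith
  have hdA : ∀ τ' ∈ Icc (T + 1) (2 * T - 1), F - inner τ' ≤ 8 * A ^ 2 / 3 := by
    intro τ' hτ'
    rw [hdiff]
    have h1 := (tail_PhiR_sq_le hψ hM hA hL hmaj (c := τ' - T) (by linarith [hτ'.1])).2
    have h2 := (tail_PhiR_sq_le hψ hM hA hL hmaj (c := 2 * T - τ') (by linarith [hτ'.2])).1
    rw [show -(τ' - T) = T - τ' by ring] at h1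
    linarith
  have hcont : Continuous inner := by
    rw [hinner]; exact continuous_formInner hψ T continuous_const
  have hcd : Continuous fun τ' ↦ F - inner τ' := continuous_const.sub hcont
  have hform : formB ψ T (fun _ ↦ 1) (fun _ ↦ 1) = ∫ τ' in T..2 * T, inner τ' := by
    unfold formB; simp only [hinner, one_mul]
  have e : T * F - formB ψ T (fun _ ↦ 1) (fun _ ↦ 1) = ∫ τ' in T..2 * T, (F - inner τ') := by
    rw [intervalIntegral.integral_sub intervalIntegrable_const (hcont.intervalIntegrable _ _),
      intervalIntegral.integral_const, hform, smul_eq_mul]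
    ring
  rw [abs_sub_comm, e]
  have hi : ∀ a b : ℝ, IntervalIntegrable (fun τ' ↦ F - inner τ') volume a b := fun a b ↦
    hcd.intervalIntegrable _ _
  rw [← intervalIntegral.integral_add_adjacent_intervals (hi T (T + 1)) (hi (T + 1) (2 * T)),
    ← intervalIntegral.integral_add_adjacent_intervals (hi (T + 1) (2 * T - 1)) (hi (2 * T - 1) (2 * T))]
  have hend : ∀ a : ℝ, |∫ τ' in a..(a + 1), (F - inner τ')| ≤ F := by
    intro a
    have h := intervalIntegral.norm_integral_le_of_norm_le_const (a := a) (b := a + 1) (C := F)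
      (f := fun τ' ↦ F - inner τ') fun τ' _ ↦ by
        rw [Real.norm_eq_abs, abs_of_nonneg (hd0 τ')]; exact hdF τ'
    rw [Real.norm_eq_abs, show a + 1 - a = (1 : ℝ) by ring, abs_one, mul_one] at h
    exact h
  have hmid : |∫ τ' in (T + 1)..(2 * T - 1), (F - inner τ')| ≤ 8 * A ^ 2 / 3 * (T - 2) := by
    have h := intervalIntegral.norm_integral_le_of_norm_le_const (a := T + 1) (b := 2 * T - 1)
      (C := 8 * A ^ 2 / 3) (f := fun τ' ↦ F - inner τ') fun τ' hτ' ↦ by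
        rw [uIoc_of_le (by linarith)] at hτ'
        rw [Real.norm_eq_abs, abs_of_nonneg (hd0 τ')]
        exact hdA τ' ⟨hτ'.1.le, hτ'.2⟩
    rw [Real.norm_eq_abs, show 2 * T - 1 - (T + 1) = T - 2 by ring,
      abs_of_nonneg (show (0 : ℝ) ≤ T - 2 by linarith)] at h
    exact h
  have h1 := hend T
  have h2 := hend (2 * T - 1)
  rw [show 2 * T - 1 + 1 = 2 * T by ring] at h2
  calc |(∫ τ' in T..(T + 1), (F - inner τ')) + ((∫ τ' in (T + 1)..(2 * T - 1), (F - inner τ')) +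
        ∫ τ' in (2 * T - 1)..(2 * T), (F - inner τ'))|
      ≤ |∫ τ' in T..(T + 1), (F - inner τ')| + (|∫ τ' in (T + 1)..(2 * T - 1), (F - inner τ')| +
        |∫ τ' in (2 * T - 1)..(2 * T), (F - inner τ')|) :=
        (abs_add_le _ _).trans (add_le_add le_rfl (abs_add_le _ _))
    _ ≤ F + (8 * A ^ 2 / 3 * (T - 2) + F) := add_le_add h1 (add_le_add hmid h2)
    _ ≤ 2 * F + 3 * A ^ 2 * T := by nlinarith [sq_nonneg A]

/-- A sup bound for the window on `[−½,½]`: `ψ ≤ B²` where `√ψ ≤ B`. [cite: AlpogeFurman2026, §2.2 (p. 4)] -/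
theorem IsWindow.le_sq_of_sqrt_le (hψ : IsWindow ψ) {B : ℝ}
    (hB : ∀ x ∈ Icc (-(1 / 2 : ℝ)) (1 / 2), Real.sqrt (ψ x) ≤ B) :
    ∀ x ∈ Icc (-(1 / 2 : ℝ)) (1 / 2), ψ x ≤ B ^ 2 := by
  intro x hx
  have h := pow_le_pow_left₀ (Real.sqrt_nonneg _) (hB x hx) 2
  rwa [Real.sq_sqrt (hψ.pos x hx).le] at h

/-- **`∫_ℝ Φ_T² ≤ 13 B⁴ L`** (`L ≥ 2`, `ψ ≤ B²` on `[−½,½]`): `∫Φ² = 2π∫φ⁴ ≤ 2π(L∫ψ² + 2B⁴) ≤ 2π·3B⁴L`.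
[cite: AlpogeFurman2026, §5.1 (p. 7: "`∫_ℝΦ² = 2πbL`", "`0 < b ≤ a ≤ 1`")] -/
theorem integral_PhiR_sq_le (hψ : IsWindow ψ) {B : ℝ}
    (hB : ∀ x ∈ Icc (-(1 / 2 : ℝ)) (1 / 2), Real.sqrt (ψ x) ≤ B) {T : ℝ} (hL : 2 ≤ logHeight T) :
    ∫ x, PhiR ψ T x ^ 2 ≤ 13 * B ^ 4 * logHeight T ∧
      ∫ u, phi ψ T u ^ 4 ≤ 2 * B ^ 4 * logHeight T := by
  have hπ4 := Real.pi_lt_d2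
  have hM := hψ.le_sq_of_sqrt_le hB
  have h4 := abs_integral_phi_pow_four_sub_le hψ hM hL
  have hψint : ∫ v in (-(1 / 2 : ℝ))..(1 / 2), ψ v ^ 2 ≤ B ^ 4 := by
    have h := intervalIntegral.norm_integral_le_of_norm_le_const (a := -(1 / 2 : ℝ)) (b := 1 / 2)
      (C := B ^ 4) (f := fun v ↦ ψ v ^ 2) fun v hv ↦ by
        rw [uIoc_of_le (by norm_num)] at hv
        have hv' : v ∈ Icc (-(1 / 2 : ℝ)) (1 / 2) := ⟨hv.1.le, hv.2⟩
        rw [Real.norm_eq_abs, abs_of_nonneg (sq_nonneg _), show B ^ 4 = (B ^ 2) ^ 2 by ring]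
        exact pow_le_pow_left₀ (hψ.pos v hv').le (hM v hv') 2
    rw [Real.norm_eq_abs, show (1 / 2 : ℝ) - -(1 / 2) = 1 by ring, abs_one, mul_one] at h
    exact (le_abs_self _).trans h
  have hL0 : 0 ≤ logHeight T := by linarith
  have hφ4 : ∫ u, phi ψ T u ^ 4 ≤ 2 * B ^ 4 * logHeight T := by
    have h1 := (abs_le.1 h4).2
    have : logHeight T * ∫ v in (-(1 / 2 : ℝ))..(1 / 2), ψ v ^ 2 ≤ logHeight T * B ^ 4 :=
      mul_le_mul_of_nonneg_left hψint hL0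
    have hB4 : 0 ≤ B ^ 4 := by positivity
    nlinarith
  refine ⟨?_, hφ4⟩
  rw [integral_PhiR_sq hψ (by linarith)]
  have hB4 : 0 ≤ B ^ 4 * logHeight T := by positivity
  nlinarith [Real.pi_pos]

end AlpogeFurman2026

open AlpogeFurman2026 in
/-- **[AF26] Proposition 5.3 (Archimedean term) for the typed model, to precision `O(TL²)`**:
for a window `ψ` there is `C ≥ 0` with
`|𝓜[μ,μ] − (TL²/2π)·∫φ_T⁴| ≤ C·T·L²` for all `T ≥ 300` with `L ≥ 10`
(`(TL²/2π)∫φ_T⁴ = (L/2π)²·T·∫_ℝΦ²`, i.e. the printed main term `2πbL·∫_Tμ²` with `μ` frozen at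
`L/2π`; the printed error `O(l² log L)` is sharper than needed and is not reproduced). Proof:
`μ = L/2π + η` with `|η| ≤ ½` on `I`, bilinearity, `|𝓜[1,η]|,|𝓜[η,1]| ≤ ½T∫Φ²`, `|𝓜[η,η]| ≤ ¼T∫Φ²`
(sup bound), `𝓜[1,1] = T∫Φ² + O(T)` (`formB_one_one_sub_le`), `∫Φ² = 2π∫φ⁴ ≪ L`.
[cite: AlpogeFurman2026, Proposition 5.3 (p. 9)] -/
theorem AlpogeFurman2026_arch_term {ψ : ℝ → ℝ} (hψ : IsWindow ψ) :
    ∃ C : ℝ, 0 ≤ C ∧ ∀ T : ℝ, 300 ≤ T → 10 ≤ logHeight T →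
      |formB ψ T archDensity archDensity -
          T * logHeight T ^ 2 / (2 * π) * ∫ u, phi ψ T u ^ 4| ≤ C * T * logHeight T ^ 2 := by
  obtain ⟨A₀, A₂, hA₀, hA₂, hmaj⟩ := exists_majorant hψ
  obtain ⟨m₀, B, K, -, hB0, -, -, hB, -⟩ := hψ.exists_bounds
  have hπ := Real.pi_gt_three
  refine ⟨13 * B ^ 4 + A₂ ^ 2, by positivity, fun T hT hL ↦ ?_⟩
  set L := logHeight T with hLdef
  have hT0 : 0 < T := by linarith
  have hL1 : 1 ≤ L := by linarith
  have hMpos : 0 < A₀ * L := by positivity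
  have hmajΦ : ∀ x : ℝ, |PhiR ψ T x| ≤ lorentz (A₀ * L) A₂ x := fun x ↦ (hmaj T hL1 x).2
  set F := ∫ x, PhiR ψ T x ^ 2 with hFdef
  obtain ⟨hFle, -⟩ := integral_PhiR_sq_le hψ hB (T := T) (by linarith)
  rw [← hLdef, ← hFdef] at hFle
  have hF0 : 0 ≤ F := integral_nonneg fun x ↦ sq_nonneg _
  have hLT := (logHeight_le_two_sqrt hT0).2
  rw [← hLdef] at hLT
  -- decomposition `μ = c₀ + η`
  set c₀ : ℝ := L / (2 * π) with hc₀
  have hc₀0 : 0 ≤ c₀ := by positivity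
  have hc₀le : c₀ ≤ L / 6 := div_le_div_of_nonneg_left (by linarith) (by norm_num) (by linarith)
  set η : ℝ → ℝ := fun τ ↦ archDensity τ - c₀ with hη
  have hηc : Continuous η := continuous_archDensity.sub continuous_const
  have h1c : Continuous fun _ : ℝ ↦ (1 : ℝ) := continuous_const
  have hcc : Continuous fun _ : ℝ ↦ c₀ := continuous_const
  have hμc : Continuous archDensity := continuous_archDensity
  have hηb : ∀ τ ∈ Icc T (2 * T), |η τ| ≤ 1 / 2 := fun τ hτ ↦ by
    rw [hη]; dsimp only; rw [hc₀, hLdef]; exact abs_archDensity_sub_le_window hT hτ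
  have h1b : ∀ τ ∈ Icc T (2 * T), |(fun _ : ℝ ↦ (1 : ℝ)) τ| ≤ 1 := fun τ _ ↦ by simp
  -- bilinear expansion
  have hμ : archDensity = fun τ ↦ c₀ + η τ := by funext τ; simp [hη]
  have e1 : formB ψ T archDensity archDensity =
      formB ψ T (fun _ ↦ c₀) archDensity + formB ψ T η archDensity := by
    have h : formB ψ T (fun τ ↦ c₀ + η τ) archDensity =
        formB ψ T (fun _ ↦ c₀) archDensity + formB ψ T η archDensity := by
      simpa using formB_add_left hψ T (u := fun _ ↦ c₀) (v := η) (w := archDensity) hcc hηc hμc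
    rw [← hμ] at h
    exact h
  have e2 : formB ψ T (fun _ ↦ c₀) archDensity =
      formB ψ T (fun _ ↦ c₀) (fun _ ↦ c₀) + formB ψ T (fun _ ↦ c₀) η := by
    have h : formB ψ T (fun _ ↦ c₀) (fun τ ↦ c₀ + η τ) =
        formB ψ T (fun _ ↦ c₀) (fun _ ↦ c₀) + formB ψ T (fun _ ↦ c₀) η := by
      simpa using formB_add_right hψ T (u := fun _ ↦ c₀) (v := fun _ ↦ c₀) (w := η) hcc hcc hηc
    rw [← hμ] at h
    exact h
  have e3 : formB ψ T η archDensity = formB ψ T η (fun _ ↦ c₀) + formB ψ T η η := by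
    have h : formB ψ T η (fun τ ↦ c₀ + η τ) = formB ψ T η (fun _ ↦ c₀) + formB ψ T η η := by
      simpa using formB_add_right hψ T (u := η) (v := fun _ ↦ c₀) (w := η) hηc hcc hηc
    rw [← hμ] at h
    exact h
  have e4 : formB ψ T (fun _ ↦ c₀) (fun _ ↦ c₀) = c₀ * (c₀ * formB ψ T (fun _ ↦ 1) (fun _ ↦ 1)) := by
    have h1 := formB_const_mul_left ψ T c₀ (fun _ ↦ (1 : ℝ)) (fun _ ↦ c₀)
    have h2 := formB_const_mul_right ψ T c₀ (fun _ ↦ (1 : ℝ)) (fun _ ↦ (1 : ℝ))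
    simp only [mul_one] at h1 h2
    rw [h1, h2]
  have e5 : formB ψ T (fun _ ↦ c₀) η = c₀ * formB ψ T (fun _ ↦ 1) η := by
    have h1 := formB_const_mul_left ψ T c₀ (fun _ ↦ (1 : ℝ)) η
    simp only [mul_one] at h1
    exact h1
  have e6 : formB ψ T η (fun _ ↦ c₀) = c₀ * formB ψ T η (fun _ ↦ 1) := by
    have h1 := formB_const_mul_right ψ T c₀ η (fun _ ↦ (1 : ℝ))
    simp only [mul_one] at h1
    exact h1
  -- the four estimates
  have hB11 := formB_one_one_sub_le hψ hMpos hA₂ (by linarith) hL1 hmajΦ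
  rw [← hFdef] at hB11
  have hB1η : |formB ψ T (fun _ ↦ 1) η| ≤ 1 * (1 / 2) * T * F :=
    abs_formB_le hψ hT0 hL1 h1c hηc h1b hηb
  have hBη1 : |formB ψ T η (fun _ ↦ 1)| ≤ (1 / 2) * 1 * T * F :=
    abs_formB_le hψ hT0 hL1 hηc h1c hηb h1b
  have hBηη : |formB ψ T η η| ≤ (1 / 2) * (1 / 2) * T * F :=
    abs_formB_le hψ hT0 hL1 hηc hηc hηb hηb
  -- the main term
  have hmain : T * L ^ 2 / (2 * π) * ∫ u, phi ψ T u ^ 4 = c₀ * (c₀ * (T * F)) := by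
    rw [hFdef, integral_PhiR_sq hψ hL1, hc₀]
    field_simp
  rw [e1, e2, e3, e4, e5, e6, hmain]
  have ekey : c₀ * (c₀ * formB ψ T (fun _ ↦ 1) (fun _ ↦ 1)) + c₀ * formB ψ T (fun _ ↦ 1) η +
      (c₀ * formB ψ T η (fun _ ↦ 1) + formB ψ T η η) - c₀ * (c₀ * (T * F)) =
      c₀ * (c₀ * (formB ψ T (fun _ ↦ 1) (fun _ ↦ 1) - T * F)) + c₀ * formB ψ T (fun _ ↦ 1) η +
        c₀ * formB ψ T η (fun _ ↦ 1) + formB ψ T η η := by ring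
  rw [ekey]
  have hA : |c₀ * (c₀ * (formB ψ T (fun _ ↦ 1) (fun _ ↦ 1) - T * F))| ≤
      c₀ * (c₀ * (2 * F + 3 * A₂ ^ 2 * T)) := by
    rw [abs_mul, abs_mul, abs_of_nonneg hc₀0]
    gcongr
  have hB' : |c₀ * formB ψ T (fun _ ↦ 1) η| ≤ c₀ * (1 * (1 / 2) * T * F) := by
    rw [abs_mul, abs_of_nonneg hc₀0]; gcongr
  have hC' : |c₀ * formB ψ T η (fun _ ↦ 1)| ≤ c₀ * ((1 / 2) * 1 * T * F) := by
    rw [abs_mul, abs_of_nonneg hc₀0]; gcongr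
  calc |c₀ * (c₀ * (formB ψ T (fun _ ↦ 1) (fun _ ↦ 1) - T * F)) + c₀ * formB ψ T (fun _ ↦ 1) η +
        c₀ * formB ψ T η (fun _ ↦ 1) + formB ψ T η η|
      ≤ |c₀ * (c₀ * (formB ψ T (fun _ ↦ 1) (fun _ ↦ 1) - T * F))| + |c₀ * formB ψ T (fun _ ↦ 1) η| +
        |c₀ * formB ψ T η (fun _ ↦ 1)| + |formB ψ T η η| := by
        refine (abs_add_le _ _).trans (add_le_add ((abs_add_le _ _).trans (add_le_add (abs_add_le _ _) le_rfl)) le_rfl)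
    _ ≤ c₀ * (c₀ * (2 * F + 3 * A₂ ^ 2 * T)) + c₀ * (1 * (1 / 2) * T * F) +
        c₀ * ((1 / 2) * 1 * T * F) + (1 / 2) * (1 / 2) * T * F := by
        gcongr
    _ ≤ (13 * B ^ 4 + A₂ ^ 2) * T * L ^ 2 := by
        -- `c₀ ≤ L/6`, `F ≤ 13B⁴L`, `L ≤ T`, `L ≥ 10`
        have hB4 : 0 ≤ B ^ 4 := by positivity
        have h1 : c₀ * (c₀ * (2 * F + 3 * A₂ ^ 2 * T)) ≤ L / 6 * (L / 6 * (2 * (13 * B ^ 4 * L) + 3 * A₂ ^ 2 * T)) := by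
          have : 2 * F + 3 * A₂ ^ 2 * T ≤ 2 * (13 * B ^ 4 * L) + 3 * A₂ ^ 2 * T := by linarith
          calc c₀ * (c₀ * (2 * F + 3 * A₂ ^ 2 * T)) ≤ c₀ * (c₀ * (2 * (13 * B ^ 4 * L) + 3 * A₂ ^ 2 * T)) := by
                gcongr
            _ ≤ L / 6 * (L / 6 * (2 * (13 * B ^ 4 * L) + 3 * A₂ ^ 2 * T)) := by
                have h0 : 0 ≤ 2 * (13 * B ^ 4 * L) + 3 * A₂ ^ 2 * T := by positivity
                exact mul_le_mul hc₀le (mul_le_mul_of_nonneg_right hc₀le h0) (by positivity) (by positivity)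
        have h2 : c₀ * (1 * (1 / 2) * T * F) ≤ L / 6 * (1 * (1 / 2) * T * (13 * B ^ 4 * L)) := by
          exact mul_le_mul hc₀le (by gcongr) (by positivity) (by positivity)
        have h3 : c₀ * ((1 / 2) * 1 * T * F) ≤ L / 6 * ((1 / 2) * 1 * T * (13 * B ^ 4 * L)) := by
          exact mul_le_mul hc₀le (by gcongr) (by positivity) (by positivity)
        have h4 : (1 / 2) * (1 / 2) * T * F ≤ (1 / 2) * (1 / 2) * T * (13 * B ^ 4 * L) := by gcongr
        have h5 : L * L * L ≤ T * L * L := by gcongr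
        nlinarith [mul_nonneg (mul_nonneg hT0.le (by positivity : (0:ℝ) ≤ L)) hB4,
          mul_nonneg hT0.le (sq_nonneg A₂), h5, mul_nonneg (by positivity : (0:ℝ) ≤ L) hB4]

/-! ## §A6. The `Π_X` cross terms (Proposition 5.5) and the split (5.11) of `𝓜` -/

open AlpogeFurman2026 in
/-- **[AF26] (5.11) with the three `Π_X` terms of Proposition 5.5 absorbed, for the typed model**:
for a window `ψ` there is `C ≥ 0` with
`|𝓜 − (𝓜[μ,μ] + 𝓜[P_X,P_X] + 2𝓜[P_X,μ])| ≤ C·T·L²` for all `T ≥ 300` with `L ≥ 10` — the three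
terms `2𝓜[μ,Π_X] + 2𝓜[P_X,Π_X] + 𝓜[Π_X,Π_X]` are `≪ T·L` by the sup bound with `|Π_X| ≤ 1/√T`,
`|μ| ≤ L`, `|P_X| ≤ (log 4+4)√T` on `I` and `∫Φ² ≪ L` (the printed "`≪_χ L²√X`"), and
`𝓜[μ,P_X] = 𝓜[P_X,μ]` by symmetry. [cite: AlpogeFurman2026, §5.3 eq. (5.11) and Proposition 5.5 (pp. 9–10)] -/
theorem AlpogeFurman2026_formM_split {ψ : ℝ → ℝ} (hψ : IsWindow ψ) :
    ∃ C : ℝ, 0 ≤ C ∧ ∀ T : ℝ, 300 ≤ T → 10 ≤ logHeight T →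
      |formM ψ T - (formB ψ T archDensity archDensity +
          formB ψ T (primeDensity (T / (2 * π))) (primeDensity (T / (2 * π))) +
          2 * formB ψ T (primeDensity (T / (2 * π))) archDensity)| ≤ C * T * logHeight T ^ 2 := by
  obtain ⟨m₀, B, K, -, hB0, -, -, hB, -⟩ := hψ.exists_bounds
  have hπ := Real.pi_gt_three
  have hπ4 := Real.pi_lt_d2
  refine ⟨3 * 9 * 13 * B ^ 4, by positivity, fun T hT hL ↦ ?_⟩
  set L := logHeight T with hLdef
  set X := T / (2 * π) with hX
  have hT0 : 0 < T := by linarith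
  have hL1 : 1 ≤ L := by linarith
  set F := ∫ x, PhiR ψ T x ^ 2 with hFdef
  obtain ⟨hFle, -⟩ := integral_PhiR_sq_le hψ hB (T := T) (by linarith)
  rw [← hLdef, ← hFdef] at hFle
  have hF0 : 0 ≤ F := integral_nonneg fun x ↦ sq_nonneg _
  obtain ⟨hL2s, hLT⟩ := logHeight_le_two_sqrt hT0
  rw [← hLdef] at hL2s hLT
  have hsT : 0 < Real.sqrt T := Real.sqrt_pos.2 hT0
  -- the three densities and their bounds on `I`
  have hμc : Continuous archDensity := continuous_archDensity
  have hPc : Continuous (primeDensity X) := continuous_primeDensity X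
  have hPic : Continuous (polarDensity X) := continuous_polarDensity X
  set Av : ℝ → ℝ := fun τ ↦ archDensity τ + primeDensity X τ with hAv
  have hAvc : Continuous Av := hμc.add hPc
  have hPib : ∀ τ ∈ Icc T (2 * T), |polarDensity X τ| ≤ 1 / Real.sqrt T := fun τ hτ ↦ by
    rw [hX]; exact abs_polarDensity_le_window (by linarith) hτ
  have hAvb : ∀ τ ∈ Icc T (2 * T), |Av τ| ≤ 9 * Real.sqrt T := by
    intro τ hτ
    have h1 := abs_archDensity_le_window hT (by linarith) hτ
    have h2 := abs_primeDensity_le_window (T := T) (by linarith) τ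
    rw [← hLdef] at h1
    rw [← hX] at h2
    have hlog4 : Real.log 4 ≤ 2 := by
      have h2' : Real.log 4 = 2 * Real.log 2 := by
        rw [show (4 : ℝ) = 2 ^ 2 by norm_num, Real.log_pow]; norm_num
      linarith [Real.log_two_lt_d9]
    calc |Av τ| ≤ |archDensity τ| + |primeDensity X τ| := abs_add_le _ _
      _ ≤ L + (Real.log 4 + 4) * Real.sqrt T := add_le_add h1 h2
      _ ≤ 9 * Real.sqrt T := by nlinarith
  -- the expansion
  have hν : weilDensity X = fun τ ↦ Av τ + polarDensity X τ := by
    funext τ; rw [weilDensity_def, hAv]; ring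
  have hAv' : Av = fun τ ↦ archDensity τ + primeDensity X τ := rfl
  have e1 : formM ψ T = formB ψ T Av (weilDensity X) + formB ψ T (polarDensity X) (weilDensity X) := by
    rw [formM_eq_formB, ← hX]
    have h : formB ψ T (fun τ ↦ Av τ + polarDensity X τ) (weilDensity X) =
        formB ψ T Av (weilDensity X) + formB ψ T (polarDensity X) (weilDensity X) :=
      formB_add_left hψ T hAvc hPic (continuous_weilDensity X)
    rw [← hν] at h
    exact h
  have e2 : formB ψ T Av (weilDensity X) = formB ψ T Av Av + formB ψ T Av (polarDensity X) := by
    have h : formB ψ T Av (fun τ ↦ Av τ + polarDensity X τ) =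
        formB ψ T Av Av + formB ψ T Av (polarDensity X) := formB_add_right hψ T hAvc hAvc hPic
    rw [← hν] at h
    exact h
  have e3 : formB ψ T (polarDensity X) (weilDensity X) =
      formB ψ T (polarDensity X) Av + formB ψ T (polarDensity X) (polarDensity X) := by
    have h : formB ψ T (polarDensity X) (fun τ ↦ Av τ + polarDensity X τ) =
        formB ψ T (polarDensity X) Av + formB ψ T (polarDensity X) (polarDensity X) :=
      formB_add_right hψ T hPic hAvc hPic
    rw [← hν] at h
    exact h
  have e4 : formB ψ T Av Av = formB ψ T archDensity archDensity +
      formB ψ T (primeDensity X) (primeDensity X) + 2 * formB ψ T (primeDensity X) archDensity := by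
    have h1 : formB ψ T Av Av = formB ψ T archDensity Av + formB ψ T (primeDensity X) Av :=
      formB_add_left hψ T hμc hPc hAvc
    have h2 : formB ψ T archDensity Av =
        formB ψ T archDensity archDensity + formB ψ T archDensity (primeDensity X) :=
      formB_add_right hψ T hμc hμc hPc
    have h3 : formB ψ T (primeDensity X) Av =
        formB ψ T (primeDensity X) archDensity + formB ψ T (primeDensity X) (primeDensity X) :=
      formB_add_right hψ T hPc hμc hPc
    have h4 : formB ψ T archDensity (primeDensity X) = formB ψ T (primeDensity X) archDensity :=
      formB_comm hψ hT0 hμc hPc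
    rw [h1, h2, h3, h4]; ring
  -- the three small terms
  have hb1 : |formB ψ T Av (polarDensity X)| ≤ 9 * Real.sqrt T * (1 / Real.sqrt T) * T * F :=
    abs_formB_le hψ hT0 hL1 hAvc hPic hAvb hPib
  have hb2 : |formB ψ T (polarDensity X) Av| ≤ (1 / Real.sqrt T) * (9 * Real.sqrt T) * T * F :=
    abs_formB_le hψ hT0 hL1 hPic hAvc hPib hAvb
  have hb3 : |formB ψ T (polarDensity X) (polarDensity X)| ≤
      (1 / Real.sqrt T) * (1 / Real.sqrt T) * T * F :=
    abs_formB_le hψ hT0 hL1 hPic hPic hPib hPib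
  have hs1 : 9 * Real.sqrt T * (1 / Real.sqrt T) * T * F = 9 * T * F := by
    field_simp
  have hs2 : (1 / Real.sqrt T) * (9 * Real.sqrt T) * T * F = 9 * T * F := by
    field_simp
  have hs3 : (1 / Real.sqrt T) * (1 / Real.sqrt T) * T * F = F := by
    rw [div_mul_div_comm, one_mul, Real.mul_self_sqrt hT0.le, one_div_mul_cancel hT0.ne', one_mul]
  rw [hs1] at hb1
  rw [hs2] at hb2
  rw [hs3] at hb3
  rw [e1, e2, e3, e4]
  have ekey : formB ψ T archDensity archDensity + formB ψ T (primeDensity X) (primeDensity X) +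
      2 * formB ψ T (primeDensity X) archDensity + formB ψ T Av (polarDensity X) +
      (formB ψ T (polarDensity X) Av + formB ψ T (polarDensity X) (polarDensity X)) -
      (formB ψ T archDensity archDensity + formB ψ T (primeDensity X) (primeDensity X) +
        2 * formB ψ T (primeDensity X) archDensity) =
      formB ψ T Av (polarDensity X) + formB ψ T (polarDensity X) Av +
        formB ψ T (polarDensity X) (polarDensity X) := by ring
  rw [ekey]
  calc |formB ψ T Av (polarDensity X) + formB ψ T (polarDensity X) Av +
        formB ψ T (polarDensity X) (polarDensity X)|
      ≤ |formB ψ T Av (polarDensity X)| + |formB ψ T (polarDensity X) Av| +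
        |formB ψ T (polarDensity X) (polarDensity X)| :=
        (abs_add_le _ _).trans (add_le_add (abs_add_le _ _) le_rfl)
    _ ≤ 9 * T * F + 9 * T * F + F := add_le_add (add_le_add hb1 hb2) hb3
    _ ≤ 3 * 9 * 13 * B ^ 4 * T * L ^ 2 := by
        have hB4 : 0 ≤ B ^ 4 := by positivity
        have h1 : F ≤ T * F := le_mul_of_one_le_left hF0 (by linarith)
        have h2 : T * F ≤ T * (13 * B ^ 4 * L) := mul_le_mul_of_nonneg_left hFle hT0.le
        have h3 : T * (13 * B ^ 4 * L) ≤ T * (13 * B ^ 4 * L) * L :=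
          le_mul_of_one_le_right (by positivity) hL1
        nlinarith

namespace AlpogeFurman2026

variable {ψ : ℝ → ℝ}

/-! ## §A7. The cross term `𝓜[μ,P_X]` (Proposition 5.5) by one integration by parts -/

/-- **First-derivative bound for a cosine integral**: if `U` has derivative `U′` on `[a,b]`
(`U′` continuous there) and `y > 0`, then `|∫_a^b U(t)cos(ty) dt| ≤ (|U(b)| + |U(a)| + ∫_a^b|U′|)/y`
(integrate by parts against `sin(ty)/y`). This is the printed "for `y ≥ log 2`, integrating by
parts, `|∫_I m(τ′)cos(τ′y)dτ′| ≤ (2 sup|m| + ∫_I|m′|)/y`". [cite: AlpogeFurman2026, Proposition 5.5 (proof), p. 10] -/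
theorem abs_integral_mul_cos_le {a b y : ℝ} (hab : a ≤ b) (hy : 0 < y) {U U' : ℝ → ℝ}
    (hU : ∀ t ∈ uIcc a b, HasDerivAt U (U' t) t) (hU'c : ContinuousOn U' (uIcc a b)) :
    |∫ t in a..b, U t * Real.cos (t * y)| ≤ (|U b| + |U a| + ∫ t in a..b, |U' t|) / y := by
  have hv : ∀ t ∈ uIcc a b, HasDerivAt (fun t ↦ Real.sin (t * y) / y) (Real.cos (t * y)) t := by
    intro t _
    have h := ((hasDerivAt_mul_const y (x := t)).sin).div_const y
    rwa [mul_div_assoc, div_self hy.ne', mul_one] at h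
  have hU'i : IntervalIntegrable U' volume a b := hU'c.intervalIntegrable
  have hv'i : IntervalIntegrable (fun t ↦ Real.cos (t * y)) volume a b :=
    (by fun_prop : Continuous fun t ↦ Real.cos (t * y)).intervalIntegrable _ _
  rw [intervalIntegral.integral_mul_deriv_eq_deriv_mul hU hv hU'i hv'i]
  have hsin : ∀ t : ℝ, |Real.sin (t * y) / y| ≤ 1 / y := fun t ↦ by
    rw [abs_div, abs_of_pos hy]
    exact div_le_div_of_nonneg_right (Real.abs_sin_le_one _) hy.le
  have h1 : |U b * (Real.sin (b * y) / y)| ≤ |U b| / y := by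
    rw [abs_mul]
    calc |U b| * |Real.sin (b * y) / y| ≤ |U b| * (1 / y) :=
          mul_le_mul_of_nonneg_left (hsin b) (abs_nonneg _)
      _ = |U b| / y := by ring
  have h2 : |U a * (Real.sin (a * y) / y)| ≤ |U a| / y := by
    rw [abs_mul]
    calc |U a| * |Real.sin (a * y) / y| ≤ |U a| * (1 / y) :=
          mul_le_mul_of_nonneg_left (hsin a) (abs_nonneg _)
      _ = |U a| / y := by ring
  have hU'ci : IntervalIntegrable (fun t ↦ |U' t|) volume a b := hU'i.abs
  have hprodc : IntervalIntegrable (fun t ↦ U' t * (Real.sin (t * y) / y)) volume a b :=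
    hU'i.mul_continuousOn (by fun_prop : Continuous fun t ↦ Real.sin (t * y) / y).continuousOn
  have h3 : |∫ t in a..b, U' t * (Real.sin (t * y) / y)| ≤ (∫ t in a..b, |U' t|) / y := by
    calc |∫ t in a..b, U' t * (Real.sin (t * y) / y)|
        ≤ ∫ t in a..b, |U' t * (Real.sin (t * y) / y)| :=
          intervalIntegral.abs_integral_le_integral_abs hab
      _ ≤ ∫ t in a..b, |U' t| * (1 / y) := by
          refine intervalIntegral.integral_mono_on hab hprodc.abs (hU'ci.mul_const _) fun t _ ↦ ?_
          rw [abs_mul]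
          exact mul_le_mul_of_nonneg_left (hsin t) (abs_nonneg _)
      _ = (∫ t in a..b, |U' t|) / y := by
          rw [intervalIntegral.integral_mul_const]; ring
  calc |U b * (Real.sin (b * y) / y) - U a * (Real.sin (a * y) / y) -
        ∫ t in a..b, U' t * (Real.sin (t * y) / y)|
      ≤ |U b * (Real.sin (b * y) / y)| + |U a * (Real.sin (a * y) / y)| +
        |∫ t in a..b, U' t * (Real.sin (t * y) / y)| := by
        refine (abs_sub _ _).trans (add_le_add (abs_sub _ _) le_rfl)
    _ ≤ |U b| / y + |U a| / y + (∫ t in a..b, |U' t|) / y := add_le_add (add_le_add h1 h2) h3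
    _ = (|U b| + |U a| + ∫ t in a..b, |U' t|) / y := by ring

/-- The sine version: `|∫_a^b U(t)sin(ty) dt| ≤ (|U(b)| + |U(a)| + ∫_a^b|U′|)/y` (by parts against
`−cos(ty)/y`). [cite: AlpogeFurman2026, Proposition 5.5 (proof), p. 10] -/
theorem abs_integral_mul_sin_le {a b y : ℝ} (hab : a ≤ b) (hy : 0 < y) {U U' : ℝ → ℝ}
    (hU : ∀ t ∈ uIcc a b, HasDerivAt U (U' t) t) (hU'c : ContinuousOn U' (uIcc a b)) :
    |∫ t in a..b, U t * Real.sin (t * y)| ≤ (|U b| + |U a| + ∫ t in a..b, |U' t|) / y := by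
  have hv : ∀ t ∈ uIcc a b, HasDerivAt (fun t ↦ -(Real.cos (t * y) / y)) (Real.sin (t * y)) t := by
    intro t _
    have h := (((hasDerivAt_mul_const y (x := t)).cos).div_const y).neg
    rwa [neg_mul, neg_div, neg_neg, mul_div_assoc, div_self hy.ne', mul_one] at h
  have hU'i : IntervalIntegrable U' volume a b := hU'c.intervalIntegrable
  have hv'i : IntervalIntegrable (fun t ↦ Real.sin (t * y)) volume a b :=
    (by fun_prop : Continuous fun t ↦ Real.sin (t * y)).intervalIntegrable _ _
  rw [intervalIntegral.integral_mul_deriv_eq_deriv_mul hU hv hU'i hv'i]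
  have hcos : ∀ t : ℝ, |-(Real.cos (t * y) / y)| ≤ 1 / y := fun t ↦ by
    rw [abs_neg, abs_div, abs_of_pos hy]
    exact div_le_div_of_nonneg_right (Real.abs_cos_le_one _) hy.le
  have h1 : |U b * -(Real.cos (b * y) / y)| ≤ |U b| / y := by
    rw [abs_mul]
    calc |U b| * |-(Real.cos (b * y) / y)| ≤ |U b| * (1 / y) :=
          mul_le_mul_of_nonneg_left (hcos b) (abs_nonneg _)
      _ = |U b| / y := by ring
  have h2 : |U a * -(Real.cos (a * y) / y)| ≤ |U a| / y := by
    rw [abs_mul]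
    calc |U a| * |-(Real.cos (a * y) / y)| ≤ |U a| * (1 / y) :=
          mul_le_mul_of_nonneg_left (hcos a) (abs_nonneg _)
      _ = |U a| / y := by ring
  have hU'ci : IntervalIntegrable (fun t ↦ |U' t|) volume a b := hU'i.abs
  have hprodc : IntervalIntegrable (fun t ↦ U' t * -(Real.cos (t * y) / y)) volume a b :=
    hU'i.mul_continuousOn (by fun_prop : Continuous fun t ↦ -(Real.cos (t * y) / y)).continuousOn
  have h3 : |∫ t in a..b, U' t * -(Real.cos (t * y) / y)| ≤ (∫ t in a..b, |U' t|) / y := by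
    calc |∫ t in a..b, U' t * -(Real.cos (t * y) / y)|
        ≤ ∫ t in a..b, |U' t * -(Real.cos (t * y) / y)| :=
          intervalIntegral.abs_integral_le_integral_abs hab
      _ ≤ ∫ t in a..b, |U' t| * (1 / y) := by
          refine intervalIntegral.integral_mono_on hab hprodc.abs (hU'ci.mul_const _) fun t _ ↦ ?_
          rw [abs_mul]
          exact mul_le_mul_of_nonneg_left (hcos t) (abs_nonneg _)
      _ = (∫ t in a..b, |U' t|) / y := by
          rw [intervalIntegral.integral_mul_const]; ring
  calc |U b * -(Real.cos (b * y) / y) - U a * -(Real.cos (a * y) / y) -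
        ∫ t in a..b, U' t * -(Real.cos (t * y) / y)|
      ≤ |U b * -(Real.cos (b * y) / y)| + |U a * -(Real.cos (a * y) / y)| +
        |∫ t in a..b, U' t * -(Real.cos (t * y) / y)| := by
        refine (abs_sub _ _).trans (add_le_add (abs_sub _ _) le_rfl)
    _ ≤ |U b| / y + |U a| / y + (∫ t in a..b, |U' t|) / y := add_le_add (add_le_add h1 h2) h3
    _ = (|U b| + |U a| + ∫ t in a..b, |U' t|) / y := by ring

/-- The smooth proxy for `μ`: `u(τ) := (1/2π)(log(max(τ,1)) − log 2π)`, `= (1/2π)log(τ/2π)` for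
`τ ≥ 1` (the leading term of (2.3)); continuous on `ℝ`, with derivative `1/(2πτ)` at `τ > 1`.
[cite: AlpogeFurman2026, §2.1 eq. (2.3) (p. 4: "`μ(τ) = (1/2π)log(|τ|/2π) + O(τ⁻²)`")] -/
def uLog (τ : ℝ) : ℝ := 1 / (2 * π) * (Real.log (max τ 1) - Real.log (2 * π))

/-- `u(τ) = (1/2π) log(τ/2π)` for `τ ≥ 1`. [cite: AlpogeFurman2026, §2.1 eq. (2.3) (p. 4)] -/
theorem uLog_eq {τ : ℝ} (hτ : 1 ≤ τ) : uLog τ = 1 / (2 * π) * Real.log (τ / (2 * π)) := by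
  rw [uLog, max_eq_left hτ, Real.log_div (by linarith) (by positivity)]

/-- `u` is continuous. [cite: AlpogeFurman2026, §2.1 eq. (2.3) (p. 4)] -/
theorem continuous_uLog : Continuous uLog := by
  unfold uLog
  refine continuous_const.mul (Continuous.sub ?_ continuous_const)
  exact Real.continuousOn_log.comp_continuous (continuous_id.max continuous_const) fun t ↦ by
    simp only [mem_compl_iff, mem_singleton_iff]
    exact (lt_of_lt_of_le zero_lt_one (le_max_right _ _)).ne'

/-- `u′(τ) = 1/(2πτ)` for `τ > 1`. [cite: AlpogeFurman2026, §2.1 eq. (2.3) (p. 4: "`μ′(τ) ≪ |τ|⁻¹`")] -/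
theorem hasDerivAt_uLog {τ : ℝ} (hτ : 1 < τ) : HasDerivAt uLog (1 / (2 * π) * τ⁻¹) τ := by
  have h : HasDerivAt (fun t ↦ 1 / (2 * π) * (Real.log t - Real.log (2 * π))) (1 / (2 * π) * τ⁻¹) τ :=
    ((Real.hasDerivAt_log (by linarith : τ ≠ 0)).sub_const _).const_mul _
  refine h.congr_of_eventuallyEq ?_
  filter_upwards [Ioi_mem_nhds hτ] with t ht
  rw [uLog, max_eq_left (le_of_lt ht)]

/-- On `I`: `0 ≤ u ≤ L` and `|μ − u| ≤ 1/T` (`T ≥ 300`, `L ≥ 1`).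
[cite: AlpogeFurman2026, §2.1 eq. (2.3) and Proposition 5.5 (proof: "`0 < μ ≤ l`"), pp. 4, 10] -/
theorem uLog_window {T : ℝ} (hT : 300 ≤ T) (hL : 1 ≤ logHeight T) {τ : ℝ} (hτ : τ ∈ Icc T (2 * T)) :
    |uLog τ| ≤ logHeight T ∧ |archDensity τ - uLog τ| ≤ 1 / T := by
  have hπ := Real.pi_gt_three
  have hT0 : 0 < T := by linarith
  have hτ1 : 1 ≤ τ := by linarith [hτ.1]
  have hτ0 : 0 < τ := by linarith
  rw [uLog_eq hτ1]
  have h2 : Real.log (τ / (2 * π)) = logHeight T + Real.log (τ / T) := by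
    rw [logHeight, ← Real.log_mul (by positivity) (by positivity)]
    congr 1
    field_simp
  have h3 : 0 ≤ Real.log (τ / T) := Real.log_nonneg (by rw [le_div_iff₀ hT0]; linarith [hτ.1])
  have h4 : Real.log (τ / T) ≤ 1 := by
    have h := Real.log_le_sub_one_of_pos (by positivity : 0 < τ / T)
    have : τ / T ≤ 2 := by rw [div_le_iff₀ hT0]; exact hτ.2
    linarith
  constructor
  · rw [h2, abs_of_nonneg (by positivity)]
    have : 1 / (2 * π) * (logHeight T + Real.log (τ / T)) ≤ 1 / 6 * (logHeight T + 1) := by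
      refine mul_le_mul (one_div_le_one_div_of_le (by norm_num) (by linarith)) (by linarith)
        (by positivity) (by norm_num)
    linarith
  · exact (abs_archDensity_sub_log_le hτ1).trans (one_div_le_one_div_of_le hT0 hτ.1)

/-- **One frequency of the cross term** (the printed bound "`≪ lL/y`" per `n`, with `y = log n ≥ log 2`):
for `T ≥ 300`, `L ≥ 10` and `y ≥ log 2`,
`|∫_I u(τ′) ∫_I Φ(τ−τ′)² cos(τy) dτ dτ′| ≤ 15·L·∫_ℝΦ²`. Proof: `∫_I Φ(τ−τ′)²cos(τy)dτ =
cos(τ′y)C(τ′) − sin(τ′y)S(τ′)` with `C, S = ∫_{T−τ′}^{2T−τ′}Φ(x)²{cos,sin}(xy)dx` (substitute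
`τ = x + τ′`), `|C|,|S| ≤ ∫Φ²`, `C′, S′` = boundary values of `Φ²{cos,sin}` (fundamental theorem of
calculus), `∫_I|C′| ≤ 2∫Φ²`; then one integration by parts (`abs_integral_mul_cos_le`) with
`U = uC`, `|U| ≤ L∫Φ²`, `∫_I|U′| ≤ ∫Φ²/6 + 2L∫Φ²`. [cite: AlpogeFurman2026, Proposition 5.5 (proof), p. 10] -/
theorem abs_integral_uLog_osc_le (hψ : IsWindow ψ) {T : ℝ} (hT : 300 ≤ T) (hL : 10 ≤ logHeight T)
    {y : ℝ} (hy : Real.log 2 ≤ y) :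
    |∫ τ' in T..2 * T, uLog τ' * ∫ τ in T..2 * T, PhiR ψ T (τ - τ') ^ 2 * Real.cos (τ * y)| ≤
      15 * logHeight T * ∫ x, PhiR ψ T x ^ 2 := by
  set L := logHeight T with hLdef
  set F := ∫ x, PhiR ψ T x ^ 2 with hFdef
  have hπ := Real.pi_gt_three
  have hT0 : 0 < T := by linarith
  have hT2 : T ≤ 2 * T := by linarith
  have hL1 : 1 ≤ L := by linarith
  have hy0 : 0 < y := lt_of_lt_of_le (by linarith [Real.log_two_gt_d9]) hy
  have hΦ := (continuous_hatR hψ T).2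
  have hΦi := integrable_PhiR_sq hψ hL1
  have hF0 : 0 ≤ F := integral_nonneg fun x ↦ sq_nonneg _
  -- the two primitives
  set gc : ℝ → ℝ := fun x ↦ PhiR ψ T x ^ 2 * Real.cos (x * y) with hgc
  set gs : ℝ → ℝ := fun x ↦ PhiR ψ T x ^ 2 * Real.sin (x * y) with hgs
  have hgcc : Continuous gc := (hΦ.pow 2).mul (by fun_prop)
  have hgsc : Continuous gs := (hΦ.pow 2).mul (by fun_prop)
  have hgc_le : ∀ x, |gc x| ≤ PhiR ψ T x ^ 2 := fun x ↦ by
    rw [hgc]; dsimp only; rw [abs_mul, abs_of_nonneg (sq_nonneg _)]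
    exact mul_le_of_le_one_right (sq_nonneg _) (Real.abs_cos_le_one _)
  have hgs_le : ∀ x, |gs x| ≤ PhiR ψ T x ^ 2 := fun x ↦ by
    rw [hgs]; dsimp only; rw [abs_mul, abs_of_nonneg (sq_nonneg _)]
    exact mul_le_of_le_one_right (sq_nonneg _) (Real.abs_sin_le_one _)
  set Gc : ℝ → ℝ := fun s ↦ ∫ x in (0 : ℝ)..s, gc x with hGc
  set Gs : ℝ → ℝ := fun s ↦ ∫ x in (0 : ℝ)..s, gs x with hGs
  have hGcd : ∀ s, HasDerivAt Gc (gc s) s := fun s ↦ (hgcc.integral_hasStrictDerivAt 0 s).hasDerivAt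
  have hGsd : ∀ s, HasDerivAt Gs (gs s) s := fun s ↦ (hgsc.integral_hasStrictDerivAt 0 s).hasDerivAt
  set C : ℝ → ℝ := fun t ↦ Gc (2 * T - t) - Gc (T - t) with hC
  set S : ℝ → ℝ := fun t ↦ Gs (2 * T - t) - Gs (T - t) with hS
  have hCeq : ∀ t, C t = ∫ x in (T - t)..(2 * T - t), gc x := fun t ↦ by
    rw [hC]; dsimp only; rw [hGc]
    exact intervalIntegral.integral_interval_sub_left (hgcc.intervalIntegrable _ _)
      (hgcc.intervalIntegrable _ _)
  have hSeq : ∀ t, S t = ∫ x in (T - t)..(2 * T - t), gs x := fun t ↦ by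
    rw [hS]; dsimp only; rw [hGs]
    exact intervalIntegral.integral_interval_sub_left (hgsc.intervalIntegrable _ _)
      (hgsc.intervalIntegrable _ _)
  -- derivative of `t ↦ a - t`
  have hlin : ∀ a t : ℝ, HasDerivAt (fun t ↦ a - t) (-1) t := fun a t ↦ by
    simpa using (hasDerivAt_id t).const_sub a
  have hCd : ∀ t, HasDerivAt C (gc (T - t) - gc (2 * T - t)) t := by
    intro t
    have h1 := (hGcd (2 * T - t)).comp t (hlin (2 * T) t)
    have h2 := (hGcd (T - t)).comp t (hlin T t)
    have h := h1.sub h2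
    have e : gc (2 * T - t) * -1 - gc (T - t) * -1 = gc (T - t) - gc (2 * T - t) := by ring
    exact h.congr_deriv e
  have hSd : ∀ t, HasDerivAt S (gs (T - t) - gs (2 * T - t)) t := by
    intro t
    have h1 := (hGsd (2 * T - t)).comp t (hlin (2 * T) t)
    have h2 := (hGsd (T - t)).comp t (hlin T t)
    have h := h1.sub h2
    have e : gs (2 * T - t) * -1 - gs (T - t) * -1 = gs (T - t) - gs (2 * T - t) := by ring
    exact h.congr_deriv e
  -- `|C|, |S| ≤ F`
  have hint_le : ∀ (g : ℝ → ℝ), Continuous g → (∀ x, |g x| ≤ PhiR ψ T x ^ 2) → ∀ a b : ℝ, a ≤ b →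
      |∫ x in a..b, g x| ≤ F := by
    intro g hg hgle a b hab
    calc |∫ x in a..b, g x| ≤ ∫ x in a..b, |g x| := intervalIntegral.abs_integral_le_integral_abs hab
      _ ≤ ∫ x in a..b, PhiR ψ T x ^ 2 :=
          intervalIntegral.integral_mono_on hab (hg.abs.intervalIntegrable _ _)
            ((hΦ.pow 2).intervalIntegrable _ _) fun x _ ↦ hgle x
      _ ≤ F := by
          rw [intervalIntegral.integral_of_le hab]
          exact setIntegral_le_integral hΦi (Eventually.of_forall fun x ↦ sq_nonneg _)
  have hCb : ∀ t, |C t| ≤ F := fun t ↦ by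
    rw [hCeq]; exact hint_le gc hgcc hgc_le _ _ (by linarith)
  have hSb : ∀ t, |S t| ≤ F := fun t ↦ by
    rw [hSeq]; exact hint_le gs hgsc hgs_le _ _ (by linarith)
  have hCc : Continuous C := by
    rw [hC]; exact continuous_iff_continuousAt.2 fun t ↦ (hCd t).continuousAt
  have hSc : Continuous S := by
    rw [hS]; exact continuous_iff_continuousAt.2 fun t ↦ (hSd t).continuousAt
  -- the inner integral: `J(t) = cos(ty) C(t) − sin(ty) S(t)`
  have hJ : ∀ t : ℝ, ∫ τ in T..2 * T, PhiR ψ T (τ - t) ^ 2 * Real.cos (τ * y) =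
      Real.cos (t * y) * C t - Real.sin (t * y) * S t := by
    intro t
    have h1 : ∫ τ in T..2 * T, PhiR ψ T (τ - t) ^ 2 * Real.cos (τ * y) =
        ∫ x in (T - t)..(2 * T - t), PhiR ψ T x ^ 2 * Real.cos ((x + t) * y) := by
      rw [← intervalIntegral.integral_comp_sub_right (fun x ↦ PhiR ψ T x ^ 2 * Real.cos ((x + t) * y)) t]
      simp only [sub_add_cancel]
    have h2 : ∀ x : ℝ, PhiR ψ T x ^ 2 * Real.cos ((x + t) * y) =
        Real.cos (t * y) * gc x - Real.sin (t * y) * gs x := by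
      intro x; rw [hgc, hgs]; dsimp only; rw [add_mul, Real.cos_add]; ring
    rw [h1]
    simp_rw [h2]
    rw [intervalIntegral.integral_sub ((hgcc.const_mul _).intervalIntegrable _ _)
      ((hgsc.const_mul _).intervalIntegrable _ _), intervalIntegral.integral_const_mul,
      intervalIntegral.integral_const_mul, ← hCeq, ← hSeq]
  simp_rw [hJ]
  have esplit : ∀ t : ℝ, uLog t * (Real.cos (t * y) * C t - Real.sin (t * y) * S t) =
      (uLog t * C t) * Real.cos (t * y) - (uLog t * S t) * Real.sin (t * y) := fun t ↦ by ring
  simp_rw [esplit]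
  have hUCc : Continuous fun t ↦ uLog t * C t := continuous_uLog.mul hCc
  have hUSc : Continuous fun t ↦ uLog t * S t := continuous_uLog.mul hSc
  have hcosc : Continuous fun t : ℝ ↦ Real.cos (t * y) := by fun_prop
  have hsinc : Continuous fun t : ℝ ↦ Real.sin (t * y) := by fun_prop
  have hi1 : IntervalIntegrable (fun t ↦ uLog t * C t * Real.cos (t * y)) volume T (2 * T) :=
    (hUCc.mul hcosc).intervalIntegrable _ _
  have hi2 : IntervalIntegrable (fun t ↦ uLog t * S t * Real.sin (t * y)) volume T (2 * T) :=
    (hUSc.mul hsinc).intervalIntegrable _ _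
  rw [intervalIntegral.integral_sub hi1 hi2]
  -- derivative data on `[T, 2T]`
  set UC' : ℝ → ℝ := fun t ↦ 1 / (2 * π) * t⁻¹ * C t + uLog t * (gc (T - t) - gc (2 * T - t)) with hUC'
  set US' : ℝ → ℝ := fun t ↦ 1 / (2 * π) * t⁻¹ * S t + uLog t * (gs (T - t) - gs (2 * T - t)) with hUS'
  have hmemI : ∀ t ∈ uIcc T (2 * T), t ∈ Icc T (2 * T) := fun t ht ↦ by rwa [uIcc_of_le hT2] at ht
  have hUCd : ∀ t ∈ uIcc T (2 * T), HasDerivAt (fun t ↦ uLog t * C t) (UC' t) t := by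
    intro t ht
    have ht1 : 1 < t := by linarith [(hmemI t ht).1]
    exact (hasDerivAt_uLog ht1).mul (hCd t)
  have hUSd : ∀ t ∈ uIcc T (2 * T), HasDerivAt (fun t ↦ uLog t * S t) (US' t) t := by
    intro t ht
    have ht1 : 1 < t := by linarith [(hmemI t ht).1]
    exact (hasDerivAt_uLog ht1).mul (hSd t)
  have hinvc : ContinuousOn (fun t : ℝ ↦ 1 / (2 * π) * t⁻¹) (uIcc T (2 * T)) :=
    ContinuousOn.mul continuousOn_const (continuousOn_inv₀.mono fun t ht ↦ by
      simp only [mem_compl_iff, mem_singleton_iff]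
      exact (lt_of_lt_of_le hT0 (hmemI t ht).1).ne')
  have hUC'c : ContinuousOn UC' (uIcc T (2 * T)) := by
    rw [hUC']
    exact (hinvc.mul hCc.continuousOn).add (continuous_uLog.continuousOn.mul
      ((hgcc.comp (continuous_const.sub continuous_id)).sub
        (hgcc.comp (continuous_const.sub continuous_id))).continuousOn)
  have hUS'c : ContinuousOn US' (uIcc T (2 * T)) := by
    rw [hUS']
    exact (hinvc.mul hSc.continuousOn).add (continuous_uLog.continuousOn.mul
      ((hgsc.comp (continuous_const.sub continuous_id)).sub
        (hgsc.comp (continuous_const.sub continuous_id))).continuousOn)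
  -- bounds for `U` at the endpoints and for `∫|U′|`
  have hub : ∀ t ∈ Icc T (2 * T), |uLog t| ≤ L := fun t ht ↦ (uLog_window hT (by linarith) ht).1
  have hUb : ∀ (V : ℝ → ℝ), (∀ t, |V t| ≤ F) → ∀ t ∈ Icc T (2 * T), |uLog t * V t| ≤ L * F := by
    intro V hV t ht
    rw [abs_mul]; exact mul_le_mul (hub t ht) (hV t) (abs_nonneg _) (by linarith)
  -- `∫_T^{2T} Φ(T−t)² dt ≤ F`, `∫_T^{2T} Φ(2T−t)² dt ≤ F`
  have hshift1 : ∫ t in T..2 * T, PhiR ψ T (T - t) ^ 2 ≤ F := by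
    rw [intervalIntegral.integral_comp_sub_left (fun x ↦ PhiR ψ T x ^ 2) T,
      show T - T = 0 by ring, show T - 2 * T = -T by ring, intervalIntegral.integral_of_le (by linarith)]
    exact setIntegral_le_integral hΦi (Eventually.of_forall fun x ↦ sq_nonneg _)
  have hshift2 : ∫ t in T..2 * T, PhiR ψ T (2 * T - t) ^ 2 ≤ F := by
    rw [intervalIntegral.integral_comp_sub_left (fun x ↦ PhiR ψ T x ^ 2) (2 * T),
      show 2 * T - T = T by ring, show 2 * T - 2 * T = 0 by ring,
      intervalIntegral.integral_of_le hT0.le]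
    exact setIntegral_le_integral hΦi (Eventually.of_forall fun x ↦ sq_nonneg _)
  have hderiv_int : ∀ (V g : ℝ → ℝ), Continuous V → Continuous g → (∀ t, |V t| ≤ F) →
      (∀ x, |g x| ≤ PhiR ψ T x ^ 2) →
      ContinuousOn (fun t ↦ 1 / (2 * π) * t⁻¹ * V t + uLog t * (g (T - t) - g (2 * T - t))) (uIcc T (2 * T)) →
      ∫ t in T..2 * T, |1 / (2 * π) * t⁻¹ * V t + uLog t * (g (T - t) - g (2 * T - t))| ≤ 3 * L * F := by
    intro V g hV hg hVb hgb hcont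
    have hpt : ∀ t ∈ Icc T (2 * T), |1 / (2 * π) * t⁻¹ * V t + uLog t * (g (T - t) - g (2 * T - t))| ≤
        1 / (2 * π) * T⁻¹ * F + L * (PhiR ψ T (T - t) ^ 2 + PhiR ψ T (2 * T - t) ^ 2) := by
      intro t ht
      have ht0 : 0 < t := lt_of_lt_of_le hT0 ht.1
      have hinv : t⁻¹ ≤ T⁻¹ := by rw [inv_le_inv₀ ht0 hT0]; exact ht.1
      refine (abs_add_le _ _).trans (add_le_add ?_ ?_)
      · rw [abs_mul, abs_mul, abs_of_pos (by positivity : (0:ℝ) < 1 / (2 * π)), abs_of_pos (inv_pos.2 ht0)]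
        gcongr
        exact hVb t
      · rw [abs_mul]
        refine mul_le_mul (hub t ht) ((abs_sub _ _).trans (add_le_add (hgb _) (hgb _))) (abs_nonneg _)
          (by linarith)
    have hbc : Continuous fun t ↦ 1 / (2 * π) * T⁻¹ * F + L * (PhiR ψ T (T - t) ^ 2 + PhiR ψ T (2 * T - t) ^ 2) :=
      continuous_const.add (continuous_const.mul (((hΦ.comp (continuous_const.sub continuous_id)).pow 2).add
        ((hΦ.comp (continuous_const.sub continuous_id)).pow 2)))
    calc ∫ t in T..2 * T, |1 / (2 * π) * t⁻¹ * V t + uLog t * (g (T - t) - g (2 * T - t))|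
        ≤ ∫ t in T..2 * T, (1 / (2 * π) * T⁻¹ * F + L * (PhiR ψ T (T - t) ^ 2 + PhiR ψ T (2 * T - t) ^ 2)) :=
          intervalIntegral.integral_mono_on hT2 (hcont.abs.intervalIntegrable) (hbc.intervalIntegrable _ _)
            fun t ht ↦ hpt t ht
      _ = 1 / (2 * π) * T⁻¹ * F * T + L * ((∫ t in T..2 * T, PhiR ψ T (T - t) ^ 2) +
            ∫ t in T..2 * T, PhiR ψ T (2 * T - t) ^ 2) := by
          have hcA : Continuous fun t : ℝ ↦ PhiR ψ T (T - t) ^ 2 :=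
            (hΦ.comp (continuous_const.sub continuous_id)).pow 2
          have hcB : Continuous fun t : ℝ ↦ PhiR ψ T (2 * T - t) ^ 2 :=
            (hΦ.comp (continuous_const.sub continuous_id)).pow 2
          have hiA : IntervalIntegrable (fun t : ℝ ↦ PhiR ψ T (T - t) ^ 2) volume T (2 * T) :=
            hcA.intervalIntegrable _ _
          have hiB : IntervalIntegrable (fun t : ℝ ↦ PhiR ψ T (2 * T - t) ^ 2) volume T (2 * T) :=
            hcB.intervalIntegrable _ _
          have hiS : IntervalIntegrable (fun t : ℝ ↦ L * (PhiR ψ T (T - t) ^ 2 + PhiR ψ T (2 * T - t) ^ 2))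
              volume T (2 * T) := (continuous_const.mul (hcA.add hcB)).intervalIntegrable _ _
          rw [intervalIntegral.integral_add intervalIntegrable_const hiS,
            intervalIntegral.integral_const, intervalIntegral.integral_const_mul,
            intervalIntegral.integral_add hiA hiB, smul_eq_mul]
          ring
      _ ≤ 1 / (2 * π) * F + L * (F + F) := by
          rw [mul_assoc (1 / (2 * π) * T⁻¹) F T, show 1 / (2 * π) * T⁻¹ * (F * T) = 1 / (2 * π) * F by
            field_simp]
          gcongr
      _ ≤ 3 * L * F := by
          have : 1 / (2 * π) ≤ 1 := by rw [div_le_one (by positivity)]; linarith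
          nlinarith
  have hIC := hderiv_int C gc hCc hgcc hCb hgc_le hUC'c
  have hIS := hderiv_int S gs hSc hgsc hSb hgs_le hUS'c
  -- integrate by parts
  have hcos := abs_integral_mul_cos_le hT2 hy0 hUCd hUC'c
  have hsin := abs_integral_mul_sin_le hT2 hy0 hUSd hUS'c
  have hI1 : T ∈ Icc T (2 * T) := ⟨le_rfl, hT2⟩
  have hI2 : 2 * T ∈ Icc T (2 * T) := ⟨hT2, le_rfl⟩
  have hcos' : |∫ t in T..2 * T, uLog t * C t * Real.cos (t * y)| ≤ 5 * L * F / y := by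
    refine hcos.trans (div_le_div_of_nonneg_right ?_ hy0.le)
    linarith [hUb C hCb _ hI2, hUb C hCb _ hI1]
  have hsin' : |∫ t in T..2 * T, uLog t * S t * Real.sin (t * y)| ≤ 5 * L * F / y := by
    refine hsin.trans (div_le_div_of_nonneg_right ?_ hy0.le)
    linarith [hUb S hSb _ hI2, hUb S hSb _ hI1]
  have hlog2 : 2 / 3 ≤ y := le_trans (by linarith [Real.log_two_gt_d9]) hy
  have hkey : 5 * L * F / y ≤ 15 / 2 * L * F := by
    rw [div_le_iff₀ hy0]
    have : 0 ≤ L * F := by positivity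
    nlinarith
  calc |(∫ t in T..2 * T, uLog t * C t * Real.cos (t * y)) - ∫ t in T..2 * T, uLog t * S t * Real.sin (t * y)|
      ≤ |∫ t in T..2 * T, uLog t * C t * Real.cos (t * y)| + |∫ t in T..2 * T, uLog t * S t * Real.sin (t * y)| :=
        abs_sub _ _
    _ ≤ 5 * L * F / y + 5 * L * F / y := add_le_add hcos' hsin'
    _ ≤ 15 * L * F := by linarith

end AlpogeFurman2026

open AlpogeFurman2026 in
/-- **[AF26] Proposition 5.5 for `𝓜[μ,P_X]` in the typed model, to precision `O(TL²)`**: for a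
window `ψ` there is `C ≥ 0` with `|𝓜[P_X,μ]| ≤ C·T·L²` for all `T ≥ 300` with `L ≥ 10`
(indeed `≪ L²√T`: `μ = u + O(1/T)` on `I` with `u = (1/2π)log(τ′/2π)`, the `O(1/T)` part by the sup
bound, and `𝓜[P_X,u] = −(1/π)Σ_{n≤X}(Λ(n)/√n)∫_I u(τ′)∫_IΦ(τ−τ′)²cos(τ log n)dτdτ′` with each
`n`-term `≤ 15L∫Φ²` by `abs_integral_uLog_osc_le`, and `Σ_{n≤X}Λ(n)/√n ≤ 2(log 4+4)√X`). The printed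
statement is "`𝓜[μ,P_X] ≪_χ L²√X`" (`= 𝓜[P_X,μ]` by symmetry, `formB_comm`).
[cite: AlpogeFurman2026, Proposition 5.5 (p. 10)] -/
theorem AlpogeFurman2026_cross_arch_prime {ψ : ℝ → ℝ} (hψ : IsWindow ψ) :
    ∃ C : ℝ, 0 ≤ C ∧ ∀ T : ℝ, 300 ≤ T → 10 ≤ logHeight T →
      |formB ψ T (primeDensity (T / (2 * π))) archDensity| ≤ C * T * logHeight T ^ 2 := by
  obtain ⟨m₀, B, K, -, hB0, -, -, hB, -⟩ := hψ.exists_bounds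
  have hπ := Real.pi_gt_three
  have hπ4 := Real.pi_lt_d2
  refine ⟨66 * 13 * B ^ 4, by positivity, fun T hT hL ↦ ?_⟩
  set L := logHeight T with hLdef
  set X := T / (2 * π) with hX
  have hT0 : 0 < T := by linarith
  have hL1 : 1 ≤ L := by linarith
  have hX2 : 2 ≤ X := by rw [hX, le_div_iff₀ (by positivity)]; linarith
  have hXT : X ≤ T := by rw [hX, div_le_iff₀ (by positivity)]; nlinarith
  set F := ∫ x, PhiR ψ T x ^ 2 with hFdef
  obtain ⟨hFle, -⟩ := integral_PhiR_sq_le hψ hB (T := T) (by linarith)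
  rw [← hLdef, ← hFdef] at hFle
  have hF0 : 0 ≤ F := integral_nonneg fun x ↦ sq_nonneg _
  have hsT : 0 < Real.sqrt T := Real.sqrt_pos.2 hT0
  have hsT' : Real.sqrt T ≤ T := by
    have h1 : 1 ≤ Real.sqrt T := by
      rw [show (1:ℝ) = Real.sqrt 1 by simp]; exact Real.sqrt_le_sqrt (by linarith)
    nlinarith [Real.mul_self_sqrt hT0.le]
  have hsX : Real.sqrt X ≤ Real.sqrt T := Real.sqrt_le_sqrt hXT
  have hlog4 : Real.log 4 ≤ 2 := by
    have h2' : Real.log 4 = 2 * Real.log 2 := by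
      rw [show (4 : ℝ) = 2 ^ 2 by norm_num, Real.log_pow]; norm_num
    linarith [Real.log_two_lt_d9]
  have hlog40 : 0 ≤ Real.log 4 := Real.log_nonneg (by norm_num)
  -- the densities
  have hPc : Continuous (primeDensity X) := continuous_primeDensity X
  have hμc : Continuous archDensity := continuous_archDensity
  set δ : ℝ → ℝ := fun τ ↦ archDensity τ - uLog τ with hδ
  have hδc : Continuous δ := hμc.sub continuous_uLog
  have hμ : archDensity = fun τ ↦ uLog τ + δ τ := by funext τ; simp [hδ]
  have hδb : ∀ τ ∈ Icc T (2 * T), |δ τ| ≤ 1 / T := fun τ hτ ↦ (uLog_window hT (by linarith) hτ).2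
  have hPb : ∀ τ ∈ Icc T (2 * T), |primeDensity X τ| ≤ (Real.log 4 + 4) * Real.sqrt T :=
    fun τ _ ↦ by rw [hX]; exact abs_primeDensity_le_window (by linarith) τ
  -- `𝓜[P, μ] = 𝓜[P, u] + 𝓜[P, δ]`
  have e1 : formB ψ T (primeDensity X) archDensity =
      formB ψ T (primeDensity X) uLog + formB ψ T (primeDensity X) δ := by
    have h : formB ψ T (primeDensity X) (fun τ ↦ uLog τ + δ τ) =
        formB ψ T (primeDensity X) uLog + formB ψ T (primeDensity X) δ :=
      formB_add_right hψ T hPc continuous_uLog hδc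
    rw [← hμ] at h
    exact h
  have hb2 : |formB ψ T (primeDensity X) δ| ≤ (Real.log 4 + 4) * Real.sqrt T * (1 / T) * T * F :=
    abs_formB_le hψ hT0 hL1 hPc hδc hPb hδb
  have hb2' : |formB ψ T (primeDensity X) δ| ≤ 6 * Real.sqrt T * F := by
    refine hb2.trans ?_
    rw [show (Real.log 4 + 4) * Real.sqrt T * (1 / T) * T * F = (Real.log 4 + 4) * (Real.sqrt T * F) by
      field_simp]
    nlinarith [mul_nonneg hsT.le hF0]
  -- `𝓜[P, u]` as a finite sum over `n ≤ X`
  set N := ⌊X⌋₊ with hN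
  set a : ℕ → ℝ := fun n ↦ (Λ n : ℝ) / Real.sqrt n with ha
  have ha0 : ∀ n, 0 ≤ a n := fun n ↦ div_nonneg ArithmeticFunction.vonMangoldt_nonneg (Real.sqrt_nonneg _)
  set J : ℕ → ℝ → ℝ := fun n τ' ↦ ∫ τ in T..2 * T, PhiR ψ T (τ - τ') ^ 2 * Real.cos (τ * Real.log n) with hJ
  have hJc : ∀ n, Continuous (J n) := fun n ↦ by
    rw [hJ]; exact continuous_formInner hψ T (by fun_prop)
  have hin : ∀ τ' : ℝ, ∫ τ in T..2 * T, PhiR ψ T (τ - τ') ^ 2 * primeDensity X τ =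
      ∑ n ∈ Finset.range (N + 1), (-(1 / π) * a n) * J n τ' := by
    intro τ'
    have e : ∀ τ : ℝ, PhiR ψ T (τ - τ') ^ 2 * primeDensity X τ =
        ∑ n ∈ Finset.range (N + 1), (-(1 / π) * a n) * (PhiR ψ T (τ - τ') ^ 2 * Real.cos (τ * Real.log n)) := by
      intro τ
      rw [primeDensity, ← hN, Finset.mul_sum, Finset.mul_sum]
      refine Finset.sum_congr rfl fun n _ ↦ ?_
      rw [ha]; ring
    simp_rw [e]
    have hi : ∀ n ∈ Finset.range (N + 1), IntervalIntegrable
        (fun τ : ℝ ↦ -(1 / π) * a n * (PhiR ψ T (τ - τ') ^ 2 * Real.cos (τ * Real.log n)))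
        volume T (2 * T) := fun n _ ↦
      ((continuous_formIntegrand hψ T τ' (by fun_prop : Continuous fun τ : ℝ ↦
        Real.cos (τ * Real.log n))).const_mul _).intervalIntegrable _ _
    rw [intervalIntegral.integral_finsetSum hi]
    refine Finset.sum_congr rfl fun n _ ↦ ?_
    rw [intervalIntegral.integral_const_mul]
  have e2 : formB ψ T (primeDensity X) uLog =
      ∑ n ∈ Finset.range (N + 1), (-(1 / π) * a n) * ∫ τ' in T..2 * T, uLog τ' * J n τ' := by
    unfold formB
    simp_rw [hin, Finset.mul_sum]
    have hi : ∀ n ∈ Finset.range (N + 1), IntervalIntegrable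
        (fun τ' ↦ uLog τ' * (-(1 / π) * a n * J n τ')) volume T (2 * T) := fun n _ ↦
      (continuous_uLog.mul (continuous_const.mul (hJc n))).intervalIntegrable _ _
    rw [intervalIntegral.integral_finsetSum hi]
    refine Finset.sum_congr rfl fun n _ ↦ ?_
    rw [← intervalIntegral.integral_const_mul]
    refine intervalIntegral.integral_congr fun τ' _ ↦ ?_
    ring
  -- each frequency
  have hterm : ∀ n ∈ Finset.range (N + 1),
      |(-(1 / π) * a n) * ∫ τ' in T..2 * T, uLog τ' * J n τ'| ≤ 1 / π * a n * (15 * L * F) := by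
    intro n _
    by_cases hn : 2 ≤ n
    · have hy : Real.log 2 ≤ Real.log n := Real.log_le_log two_pos (by exact_mod_cast hn)
      have h := abs_integral_uLog_osc_le hψ hT hL hy
      rw [← hLdef, ← hFdef] at h
      rw [abs_mul, show |-(1 / π) * a n| = 1 / π * a n by
        rw [abs_mul, abs_neg, abs_of_pos (by positivity : (0:ℝ) < 1 / π), abs_of_nonneg (ha0 n)]]
      exact mul_le_mul_of_nonneg_left h (by positivity : (0:ℝ) ≤ 1 / π * a n)
    · have hz : a n = 0 := by
        rw [ha]; dsimp only
        have hn' : n < 2 := not_le.1 hn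
        interval_cases n
        · simp [ArithmeticFunction.map_zero]
        · simp [ArithmeticFunction.vonMangoldt_apply_one]
      rw [hz]; simp
  have hb1 : |formB ψ T (primeDensity X) uLog| ≤ 1 / π * (15 * L * F) * ∑ n ∈ Finset.range (N + 1), a n := by
    rw [e2]
    refine (Finset.abs_sum_le_sum_abs _ _).trans ?_
    rw [Finset.mul_sum]
    refine Finset.sum_le_sum fun n hn ↦ (hterm n hn).trans (le_of_eq ?_)
    ring
  have hsum : ∑ n ∈ Finset.range (N + 1), a n ≤ 2 * (Real.log 4 + 4) * Real.sqrt X := by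
    rw [hN, Finset.range_eq_Ico, Finset.Ico_add_one_right_eq_Icc]
    exact sum_vonMangoldt_div_sqrt_le hX2
  have hb1' : |formB ψ T (primeDensity X) uLog| ≤ 60 * L * F * Real.sqrt T := by
    refine hb1.trans ?_
    have h1 : 1 / π ≤ 1 / 3 := one_div_le_one_div_of_le (by norm_num) hπ.le
    have h2 : ∑ n ∈ Finset.range (N + 1), a n ≤ 12 * Real.sqrt T := by
      refine hsum.trans ?_; nlinarith [Real.sqrt_nonneg X]
    have hLF : 0 ≤ L * F := by positivity
    calc 1 / π * (15 * L * F) * ∑ n ∈ Finset.range (N + 1), a n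
        ≤ 1 / 3 * (15 * L * F) * (12 * Real.sqrt T) := by
          refine mul_le_mul (mul_le_mul_of_nonneg_right h1 (by positivity)) h2
            (Finset.sum_nonneg fun n _ ↦ ha0 n) (by positivity)
      _ = 60 * L * F * Real.sqrt T := by ring
  -- assemble
  rw [e1]
  calc |formB ψ T (primeDensity X) uLog + formB ψ T (primeDensity X) δ|
      ≤ |formB ψ T (primeDensity X) uLog| + |formB ψ T (primeDensity X) δ| := abs_add_le _ _
    _ ≤ 60 * L * F * Real.sqrt T + 6 * Real.sqrt T * F := add_le_add hb1' hb2'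
    _ ≤ 66 * 13 * B ^ 4 * T * L ^ 2 := by
        have hB4 : 0 ≤ B ^ 4 := by positivity
        have h1 : L * F * Real.sqrt T ≤ L * (13 * B ^ 4 * L) * T :=
          mul_le_mul (mul_le_mul_of_nonneg_left hFle (by positivity)) hsT' hsT.le (by positivity)
        have h2 : Real.sqrt T * F ≤ T * (13 * B ^ 4 * L) := mul_le_mul hsT' hFle hF0 hT0.le
        have h3 : T * (13 * B ^ 4 * L) ≤ T * (13 * B ^ 4 * L) * L :=
          le_mul_of_one_le_right (by positivity) hL1
        nlinarith

end Literature.NumberTheory.LFunctions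

end
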